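import Mathlib
import Literature.NumberTheory.LFunctions.Zhang2022.Section10CRanges1422
import Literature.NumberTheory.LFunctions.Zhang2022.Section12Lemma121
import Literature.NumberTheory.LFunctions.Zhang2022.Section12Ded1217Splits
import Literature.NumberTheory.LFunctions.Zhang2022.Section10Range1113
import Literature.NumberTheory.LFunctions.Zhang2022.SkeletonAlpha1
import HarnessLib

/-!
# Zhang (2022) §12 p. 73: the top range `P″₁ < dr < P₂` of `S_j(𝐚₁₅,𝐚₂₂)` (node Z22:§12.u049) in the
# EXACT main-value reading of Lemma 12.1 — as an edge from the relative Lemma 8.4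

Topic `Literature/NumberTheory/LFunctions/Zhang2022` (Landau–Siegel audit tree; verdict-neutral).
Y. Zhang, *Discrete mean estimates and the Landau–Siegel zero*, arXiv:2211.02515v1 (2022)
[Zhang2022LandauSiegel] — **an unrefereed manuscript under adjudication**; this theorem-only file
(ZHANG-L discharge lane, WP12, seat zl-w12-p9) introduces no definition and no `Prop` fact and
asserts nothing about Theorems 1–2 of the source or about Landau–Siegel zeros.

The printed sentence [Z22 p. 73, tex L3694]: "By lemma 8.2, 8.3 and 12.3 [read: Lemmas 8.3/8.4 for the
`ξ₀ⱼ`-sum, Lemma 12.1 for the `ϰ₁₃`-sum], the sum over `P″₁ < dr < P₂` [of `S_j(𝐚₁₅,𝐚₂₂)`] is equal to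
`(L′²ι₃/((0.504)(0.498)log²P))Σ_{P^{0.496}<n<P^{0.498}}|χ(n)|λ₀ⱼ(n)φ(n)⁻¹𝓖_{j6}(P^{0.498}/n)𝓦*_j(n)
+ (L′²ι₄/((0.504)(0.5)log²P))Σ_{P^{0.496}<n<P^{0.5}}(…)𝓖_{j7}(P^{0.5}/n)𝓦*_j(n) + o(α)`". The typed
node `Typed.Sec12C.Step12u049` carries the weight `𝓦*_j` in the LINEARISED form printed in the
statement of Lemma 12.1 (`𝓦*⁰_j(n) = −1 + (2β₆ − β_j)log(n/P″₁)`, with the refuted pointwise rounding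
`|ε₁ⱼ| < 10⁻⁵` as a `10⁻⁵`-carrier, cf. `Numerics.not_lemma121Pointwise_num_one/two/three`). THIS FILE
proves the range evaluation with the weight Lemma 12.1's PROOF actually delivers — the tree's THEOREM
`Typed.Sec12B.U020_holds`: `Σ_l χ(l)ϰ₁₃(nl)l^{β_j−1} = L′(1,χ)(n/P″₁)^{−β₆}(−1 + (β₆ − β_j)log(n/P″₁))/log P₁
+ O(T^{−1} + 𝓛⁻¹⁵)` on `P″₁ < n < P₂` — i.e. with

  `𝓦*ex_j(n) = (n/P″₁)^{−β₆}(−1 + (β₆ − β_j)log(n/P″₁))`,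

and with the `n`-windows `P″₁ < n < P₃ = P^{0.498}` (the `ι₃𝓖_{j6}`-part) and `P″₁ < n < P₂` (the
`ι₄𝓖_{j7}`-part), as the EDGE

* `Typed.Sec12C.sjOn_top_a15_sum_of_rel : Skeleton.Lemma84Rel c′ → (∀ ε > 0, ForAllLarge …
  ‖SjOn c′ D j a15 (a22 χ) (rngTop D) − (X₆ + X₇)‖ ≤ εα)` (statement spelled out; no new definition).

The proof is the §12 twin of the tree's `Typed.Sec10C.mid1422Eval_of_rel`/`top1422Eval_of_rel`
(`Section10CRanges1422`, seat L3-t4): the SECOND sequence `𝐚₂₂` is the same, so the `n`-sum layer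
(relative Lemma 8.4 via `Ranges1422.norm_nSum22_sub_main_le`, windows via
`XiZeroMajorant.xiZeroTailMean`), the abstract assembly `Ranges1422.range_assembly_bound₃` with (8.10)
(`Section8FrontEnd810.eq810_holds`), the profile swap `Ranges1422.norm_G_sub_Gpr_le` and the weight sums
`Ranges1422.sum_weights_le` are re-used verbatim; only the `m`-sum layer changes (Lemma 10.1 ↦
`U020_holds`). The range `(P″₁, P₂)` is split at `P₃` (for `dr ≥ P₃` the `ϰ̄₃`-part of the `n`-sum is
empty, `Ranges1422.nSum22_eq_S84_top`); the Lemma-8.4 windows are `[P₃/T, P₃)` and `[P₂/T, P₂)`.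

What this file is NOT: a proof of the typed node `Step12u049` as printed (linearised weight), of
Lemma 8.4, or of (12.16)/(12.17).

## References

* [Zhang2022LandauSiegel] Y. Zhang, arXiv:2211.02515v1 (2022), §12 p. 73 (tex L3683–L3704),
  Lemma 12.1 p. 68, §8 Lemma 8.4 p. 46, (8.10) p. 47; §10 pp. 59–60 (the template).
-/

noncomputable section

open Complex Real ComplexConjugate Finset
open Literature.NumberTheory.LFunctions.Zhang2022.Skeleton
open Literature.NumberTheory.LFunctions.Zhang2022.Typed.Sec10C (nSum22)
open Literature.NumberTheory.LFunctions.Zhang2022.Typed.Sec10C.Ranges1422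

namespace Literature.NumberTheory.LFunctions.Zhang2022.Typed.Sec12C

namespace TopRangeA15

/-! ## Part P. Parameter facts -/

section Params

variable {D : ℕ}

/-- `T^{−c} ≤ 𝓛⁻¹⁵` once `𝓛 ≥ (15/c)^{10}` (`T = exp 𝓛^{1.1}`, `15 log 𝓛 ≤ 15𝓛 ≤ c𝓛^{1.1}`).
[cite: Zhang2022LandauSiegel, §6 p. 30 (the parameter `T`)] -/
theorem bigT_rpow_neg_le_fifteen {c : ℝ} (hc : 0 < c) (h1 : 1 ≤ ell D) (h : (15 / c) ^ 10 ≤ ell D) :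
    bigT D ^ (-c) ≤ (ell D ^ 15)⁻¹ := by
  have hℓ0 : 0 < ell D := by linarith
  have hT : bigT D ^ (-c) = Real.exp (-(c * ell D ^ (1.1 : ℝ))) := by
    rw [bigT, ← Real.exp_mul]; ring_nf
  have hL : (ell D ^ 15)⁻¹ = Real.exp (-(15 * Real.log (ell D))) := by
    rw [Real.exp_neg, show 15 * Real.log (ell D) = Real.log (ell D ^ 15) by
      rw [Real.log_pow]; norm_num, Real.exp_log (by positivity)]
  rw [hT, hL, Real.exp_le_exp, neg_le_neg_iff]
  have hlog : Real.log (ell D) ≤ ell D := (Real.log_le_sub_one_of_pos hℓ0).trans (by linarith)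
  have h01 : 15 / c ≤ ell D ^ (0.1 : ℝ) := by
    have h' : ((15 / c) ^ 10) ^ (0.1 : ℝ) ≤ ell D ^ (0.1 : ℝ) :=
      Real.rpow_le_rpow (by positivity) h (by norm_num)
    rwa [← Real.rpow_natCast, ← Real.rpow_mul (by positivity),
      show ((10 : ℕ) : ℝ) * (0.1 : ℝ) = 1 by norm_num, Real.rpow_one] at h'
  have h7 : 15 ≤ c * ell D ^ (0.1 : ℝ) := by
    rw [div_le_iff₀ hc] at h01; linarith
  have hsplit : ell D ^ (1.1 : ℝ) = ell D * ell D ^ (0.1 : ℝ) := by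
    rw [show (1.1 : ℝ) = 1 + 0.1 by norm_num, Real.rpow_add hℓ0, Real.rpow_one]
  rw [hsplit]
  calc 15 * Real.log (ell D) ≤ 15 * ell D := by gcongr
    _ ≤ c * ell D ^ (0.1 : ℝ) * ell D := mul_le_mul_of_nonneg_right h7 hℓ0.le
    _ = c * (ell D * ell D ^ (0.1 : ℝ)) := by ring

/-- `P″₁ = P^{0.496}·Dt₀ ≥ P^{0.496}` and `P₂ ≤ P^{0.5}`, `P₃ = P^{0.498}`, for `𝓛 ≥ 3`.
[cite: Zhang2022LandauSiegel, §12 p. 67 (`P″₁`), §2 (2.21) (`P₂, P₃`)] -/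
theorem window_facts (hℓ : 3 ≤ ell D) :
    bigP D ^ (0.496 : ℝ) ≤ P1pp D ∧ P1pp D = bigP D ^ (0.496 : ℝ) * ((D : ℝ) * t0 D) ∧
      Skeleton.P2 D ≤ bigP D ^ (0.5 : ℝ) ∧ Skeleton.P3 D = bigP D ^ (0.498 : ℝ) ∧
      Skeleton.P2 D = bigP D ^ (0.5 : ℝ) / bigT D ^ 10 := by
  have hDt := Dt0_ge_one hℓ
  have e : P1pp D = bigP D ^ (0.496 : ℝ) * ((D : ℝ) * t0 D) := by rw [P1pp]; ring
  refine ⟨?_, e, ?_, rfl, rfl⟩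
  · rw [e]; exact le_mul_of_one_le_right (bigP_rpow_pos D _).le hDt
  · rw [Skeleton.P2]
    exact div_le_self (bigP_rpow_pos D _).le (one_le_pow₀ (Sec12D.one_le_bigT D))

end Params

/-! ## Part R. `S_j(𝐚₁₅,𝐚₂₂)` restricted to a range, re-indexed by `n = dr` -/

section Reindex

variable (c' : ℝ) {D : ℕ} (χ : DirichletCharacter ℂ D)

/-- A real character satisfies `χ(a)² = |χ(a)|`. [folklore] -/
private theorem mul_self_of_isQuadratic' (hq : χ.IsQuadratic) (a : ZMod D) :
    χ a * χ a = (‖χ a‖ : ℂ) := by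
  rcases hq a with h | h | h <;> simp [h]

/-- A real character is fixed by complex conjugation. [folklore] -/
private theorem conj_apply_of_isQuadratic' (hq : χ.IsQuadratic) (a : ZMod D) : conj (χ a) = χ a := by
  rcases hq a with h | h | h <;> simp [h]

/-- **The truncated `m`-sum is Lemma 12.1's sum.** For `n ≥ 1` and `𝓛 ≥ 3`:
`Σ_{1≤m<⌈PT⁻²⌉} χ(m)ϰ₁₃(nm)m^{β_j−1} = Σ_{1≤l<⌈P″₂⌉} χ(l)ϰ₁₃(nl)l^{β_j−1}` (`= sum121 c′ χ j n`): both
truncations contain the support `nm < P″₂` of `ϰ₁₃(nm)`. [cite: Zhang2022LandauSiegel, §12 Lemma 12.1 p. 68] -/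
theorem mSum15_eq_sum121 (hℓ : 3 ≤ ell D) (j : ℕ) {n : ℕ} (hn : 1 ≤ n) :
    ∑ m ∈ Finset.Ico 1 (Nsupp D), χ (m : ZMod D) * vk13 D (n * m) / (m : ℂ) ^ (1 - betaJ c' D j) =
      Typed.Sec12B.sum121 c' χ j n := by
  have hℓ' : 3 ≤ Real.log D := by simpa only [ell] using hℓ
  have hN := Sec12D.ceil_P2pp_le_Nsupp (D := D) hℓ'
  unfold Typed.Sec12B.sum121
  rw [← Finset.sum_Ico_consecutive _ (Nat.one_le_iff_ne_zero.mpr (by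
      intro h0
      rw [Nat.ceil_eq_zero] at h0
      linarith [Typed.Sec12B.P2pp_pos (D := D) (three_le_of_ell hℓ)])) hN]
  have htail : ∑ m ∈ Finset.Ico ⌈P2pp D⌉₊ (Nsupp D),
      χ (m : ZMod D) * vk13 D (n * m) / (m : ℂ) ^ (1 - betaJ c' D j) = 0 := by
    refine Finset.sum_eq_zero fun m hm => ?_
    rw [Finset.mem_Ico] at hm
    have hmP : P2pp D ≤ (m : ℝ) := Nat.ceil_le.mp hm.1
    have hnm : P2pp D ≤ ((n * m : ℕ) : ℝ) := by
      refine hmP.trans ?_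
      have : (m : ℝ) * 1 ≤ (m : ℝ) * n := by gcongr; exact_mod_cast hn
      push_cast; nlinarith
    rw [Sec12D.vk13_eq_zero_of_le hnm]; simp
  rw [htail, add_zero]

/-- **`S_j(𝐚₁₅,𝐚₂₂)` restricted to a range `R` below `P^{0.504}`, re-indexed by `n = dr`** (the u047
expansion `Typed.Sec12C.step12u047_holds` with the range indicator, then `Skeleton.sum_box_ite_eq_sum_divisors`):
`SjOn(j;R) = Σ_{n∈R} Σ_{r∣n, μ²(r)=1} |χ(n)|λ₀ⱼ(n)/(nφ(r)) · sum121(j,n) · nSum22(j; n/r, r)` for real `χ`.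
[cite: Zhang2022LandauSiegel, §12 p. 73 (tex L3683)] -/
theorem SjOn_a15_eq_divisor_sum (hℓ : 3 ≤ ell D) (hq : χ.IsQuadratic) (j : ℕ) (a15 : ℕ → ℂ)
    (ha15 : ∀ n, a15 n = χ (n : ZMod D) * vk13 D n) (R : ℕ → Prop) [DecidablePred R]
    (hR : ∀ n : ℕ, R n → (n : ℝ) < bigP D ^ (0.504 : ℝ)) :
    SjOn c' D j a15 (a22 χ) R =
      ∑ n ∈ (Finset.Ico 1 (Nsupp D)).filter R, ∑ r ∈ n.divisors,
        (if Squarefree r then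
          (‖χ (n : ZMod D)‖ : ℂ) * lamZero c' D j n / (n : ℂ) / (Nat.totient r : ℂ) *
            Typed.Sec12B.sum121 c' χ j n * nSum22 c' χ j (n / r) r else 0) := by
  classical
  obtain ⟨-, -, -, -, -, -, hN⟩ := range_facts (D := D) hℓ
  -- Step 1: the u047 expansion with the range indicator
  have step1 : SjOn c' D j a15 (a22 χ) R =
      ∑ d ∈ Finset.Ico 1 (Nsupp D), ∑ r ∈ Finset.Ico 1 (Nsupp D),
        (if R (d * r) then
          (‖χ (d : ZMod D)‖ : ℂ) * (‖((ArithmeticFunction.moebius r : ℤ) : ℂ) * χ (r : ZMod D)‖ : ℂ) *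
              lamZero c' D j (d * r) / (((d * r : ℕ) : ℂ) * (Nat.totient r : ℂ)) *
            (∑ m ∈ Finset.Ico 1 (Nsupp D),
              χ (m : ZMod D) * vk13 D (d * r * m) / (m : ℂ) ^ (1 - betaJ c' D j)) *
            nSum22 c' χ j d r else 0) := by
    unfold SjOn
    refine Finset.sum_congr rfl fun d _ => Finset.sum_congr rfl fun r _ => ?_
    by_cases hRdr : R (d * r)
    · rw [if_pos hRdr, if_pos hRdr]
      have hM : (∑ m ∈ Finset.Ico 1 (Nsupp D), a15 (d * r * m) / (m : ℂ) ^ (1 - betaJ c' D j)) =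
          χ (d : ZMod D) * χ (r : ZMod D) * ∑ m ∈ Finset.Ico 1 (Nsupp D), χ (m : ZMod D) *
            vk13 D (d * r * m) / (m : ℂ) ^ (1 - betaJ c' D j) := by
        rw [Finset.mul_sum]
        refine Finset.sum_congr rfl fun m _ => ?_
        rw [ha15]
        simp only [Nat.cast_mul, map_mul]
        ring
      have hNs : (∑ n ∈ Finset.Ico 1 (Nsupp D), a22 χ (d * r * n) * xiZero c' D j n d r / (n : ℂ)) =
          χ (d : ZMod D) * χ (r : ZMod D) * nSum22 c' χ j d r := by
        unfold nSum22
        rw [Finset.mul_sum]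
        refine Finset.sum_congr rfl fun n _ => ?_
        simp only [a22, a12, Nat.cast_mul, map_mul, map_add, Complex.conj_conj,
          conj_apply_of_isQuadratic' χ hq]
        ring
      have hμ : (((ArithmeticFunction.moebius r).natAbs : ℕ) : ℂ) =
          (‖((ArithmeticFunction.moebius r : ℤ) : ℂ)‖ : ℂ) := by
        rw [Complex.norm_intCast, ← Complex.ofReal_natCast, Nat.cast_natAbs, Int.cast_abs]
      rw [hM, hNs, hμ]
      have e1 := mul_self_of_isQuadratic' χ hq (d : ZMod D)
      have e2 := mul_self_of_isQuadratic' χ hq (r : ZMod D)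
      have e3 : (‖((ArithmeticFunction.moebius r : ℤ) : ℂ) * χ (r : ZMod D)‖ : ℂ) =
          (‖((ArithmeticFunction.moebius r : ℤ) : ℂ)‖ : ℂ) * (‖χ (r : ZMod D)‖ : ℂ) := by
        rw [norm_mul]; push_cast; ring
      rw [e3, ← e1, ← e2]
      ring
    · rw [if_neg hRdr, if_neg hRdr]
  rw [step1, sum_box_ite_eq_sum_divisors (Nsupp D) R (fun n hn => hN n (hR n hn))]
  refine Finset.sum_congr rfl fun n hn => Finset.sum_congr rfl fun r hr => ?_
  have hn0 : n ≠ 0 := by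
    have := (Finset.mem_Ico.mp (Finset.mem_filter.mp hn).1).1; omega
  have hn1 : 1 ≤ n := Nat.one_le_iff_ne_zero.mpr hn0
  have hrd : r ∣ n := Nat.dvd_of_mem_divisors hr
  have hr0 : r ≠ 0 := Nat.pos_iff_ne_zero.mp (Nat.pos_of_mem_divisors hr)
  have hdr : n / r * r = n := Nat.div_mul_cancel hrd
  rw [norm_chi_mul_norm_moebius_chi χ (n / r) r, hdr, mSum15_eq_sum121 c' χ hℓ j hn1]
  split_ifs with hsq
  · have hnC : (n : ℂ) ≠ 0 := by exact_mod_cast hn0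
    have hφ : (Nat.totient r : ℂ) ≠ 0 := by
      exact_mod_cast (Nat.totient_pos.mpr (Nat.pos_of_ne_zero hr0)).ne'
    field_simp
  · simp

end Reindex

/-! ## Part M. The `m`-sum layer: Lemma 12.1 in the exact reading (`U020_holds`) -/

section MLayer

variable (c' : ℝ) {D : ℕ} [NeZero D] (χ : DirichletCharacter ℂ D)

/-- **The exact main value of the `m`-sum is `O(𝓛⁻⁷)`**: for `P″₁ < n < P₂`, `𝓛 ≥ 3`, `5|c′|α𝓛 ≤ 1`,
`‖L′(1,χ)(n/P″₁)^{−β₆}/log P₁·(−1 + (β₆ − β_j)log(n/P″₁))‖ ≤ 28000e^{9/2}𝓛⁻⁷` (`|(n/P″₁)^{−β₆}| = 1`,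
`log P₁ = 0.504𝓛⁹`, `0 ≤ log(n/P″₁) ≤ 𝓛⁹`, `|β₆ − β_j| ≤ 5.5α`, `|L′(1,χ)| ≤ 4e^{9/2}𝓛²`).
[cite: Zhang2022LandauSiegel, §12 Lemma 12.1 p. 68] -/
theorem norm_M0_le (hℓ : 3 ≤ ell D) (hp : χ.IsPrimitive) (hc5 : 5 * |c'| * alpha D * ell D ≤ 1)
    (j : ℕ) {n : ℕ} (hlo : P1pp D < n) (hhi : (n : ℝ) < Skeleton.P2 D) :
    ‖deriv χ.LFunction 1 * (((n : ℝ) / P1pp D : ℝ) : ℂ) ^ (-beta6 D) /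
          (Real.log (Skeleton.P1 D) : ℂ) *
        (-1 + (beta6 D - betaJ c' D j) * (Real.log ((n : ℝ) / P1pp D) : ℂ))‖ ≤
      28000 * Real.exp (9 / 2) * (ell D ^ 7)⁻¹ := by
  obtain ⟨hα, hαeq, hαℓ⟩ := alpha_facts hℓ
  have hℓ0 : 0 < ell D := by linarith
  have hℓ' : 3 ≤ Real.log D := by simpa only [ell] using hℓ
  obtain ⟨h496, -, hP2le, -, -⟩ := window_facts (D := D) hℓ
  have hP1pp : 0 < P1pp D := Sec12D.P1pp_pos (D := D) (by linarith)
  have hn0 : (0 : ℝ) < n := hP1pp.trans hlo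
  have hratio : 1 < (n : ℝ) / P1pp D := by rw [lt_div_iff₀ hP1pp]; linarith
  have hratio0 : 0 < (n : ℝ) / P1pp D := by linarith
  -- `|(n/P″₁)^{−β₆}| = 1`
  have hcpow : ‖(((n : ℝ) / P1pp D : ℝ) : ℂ) ^ (-beta6 D)‖ = 1 := by
    rw [Complex.norm_cpow_eq_rpow_re_of_pos hratio0]
    have : (-beta6 D).re = 0 := by rw [Complex.neg_re, beta6_re]; simp
    rw [this, Real.rpow_zero]
  -- `log P₁ = 0.504 𝓛⁹`
  have hlogP1 : Real.log (Skeleton.P1 D) = 0.504 * ell D ^ 9 := by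
    rw [Sec12D.log_P1_eq_mul, Typed.Sec12A.log_bigP]
  have hlogP1pos : 0 < Real.log (Skeleton.P1 D) := by rw [hlogP1]; positivity
  -- `0 ≤ log(n/P″₁) ≤ 𝓛⁹`
  have hlog0 : 0 ≤ Real.log ((n : ℝ) / P1pp D) := Real.log_nonneg hratio.le
  have hlogle : Real.log ((n : ℝ) / P1pp D) ≤ ell D ^ 9 := by
    have h1 : (n : ℝ) / P1pp D ≤ bigP D := by
      rw [div_le_iff₀ hP1pp]
      have hP5 : bigP D ^ (0.5 : ℝ) ≤ bigP D := (range_facts (D := D) hℓ).2.2.2.2.2.1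
      have h2 : (2 : ℝ) ≤ bigP D ^ (0.496 : ℝ) := (range_facts (D := D) hℓ).1
      nlinarith [Real.exp_pos (ell D ^ 9)]
    exact (log_le_of_le_bigP hratio.le h1).2
  -- `|β₆ − β_j| ≤ 1.5α + 4α`
  have hβ6 : ‖beta6 D‖ ≤ 1.5 * alpha D := by
    rw [beta6, norm_div, norm_mul, norm_mul, Complex.norm_I, Complex.norm_real,
      Real.norm_of_nonneg hα.le]
    norm_num
    linarith
  have hβj := Section8AbelProfiles.norm_betaJ_le c' hα.le hℓ0.le hc5 j
  have hdiff : ‖beta6 D - betaJ c' D j‖ ≤ 5.5 * alpha D :=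
    (norm_sub_le _ _).trans (by linarith)
  have hw : ‖(-1 : ℂ) + (beta6 D - betaJ c' D j) * (Real.log ((n : ℝ) / P1pp D) : ℂ)‖ ≤ 20 := by
    calc _ ≤ ‖(-1 : ℂ)‖ + ‖(beta6 D - betaJ c' D j) * (Real.log ((n : ℝ) / P1pp D) : ℂ)‖ :=
          norm_add_le _ _
      _ = 1 + ‖beta6 D - betaJ c' D j‖ * Real.log ((n : ℝ) / P1pp D) := by
          rw [norm_neg, norm_one, norm_mul, Complex.norm_real, Real.norm_of_nonneg hlog0]
      _ ≤ 1 + 5.5 * alpha D * ell D ^ 9 := by gcongr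
      _ ≤ 20 := by rw [mul_assoc, hαℓ]; nlinarith [Real.pi_lt_d2]
  have hL := norm_deriv_L_one_le χ hℓ hp
  rw [norm_mul, norm_div, norm_mul, hcpow, mul_one, Complex.norm_real, Real.norm_of_nonneg hlogP1pos.le,
    hlogP1]
  have h72 : ell D ^ 9 = ell D ^ 7 * ell D ^ 2 := by ring
  calc ‖deriv χ.LFunction 1‖ / (0.504 * ell D ^ 9) *
        ‖(-1 : ℂ) + (beta6 D - betaJ c' D j) * (Real.log ((n : ℝ) / P1pp D) : ℂ)‖
      ≤ 4 * Real.exp (9 / 2) * ell D ^ 2 / (0.504 * ell D ^ 9) * 20 := by gcongr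
    _ = (4 * Real.exp (9 / 2) * 20 / 0.504) * (ell D ^ 7)⁻¹ := by
        rw [h72]; field_simp
    _ ≤ 28000 * Real.exp (9 / 2) * (ell D ^ 7)⁻¹ := by
        have he : 0 < Real.exp (9 / 2 : ℝ) := Real.exp_pos _
        have hkey : 4 * Real.exp (9 / 2) * 20 / 0.504 ≤ 28000 * Real.exp (9 / 2) := by
          rw [div_le_iff₀ (by norm_num)]; nlinarith
        exact mul_le_mul_of_nonneg_right hkey (by positivity)

/-- **The `m`-sum against its exact main value**, from the two clauses of `U020` at this modulus: for
`P″₁ < n < P₂`, `‖sum121(j,n) − L′(1,χ)(n/P″₁)^{−β₆}/log P₁·(−1 + (β₆ − β_j)log(n/P″₁))‖ ≤ C(T^{−c} + 𝓛⁻¹⁵)`.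
[cite: Zhang2022LandauSiegel, §12 proof of Lemma 12.1 p. 68] -/
theorem norm_sum121_sub_M0_le (j : ℕ) {n : ℕ} {c C : ℝ}
    (h020 : ∀ j ∈ ({1, 2, 3} : Finset ℕ), ∀ d : ℕ, 1 ≤ d → P1pp D < d → (d : ℝ) < Skeleton.P2 D →
      ‖Typed.Sec12B.sum121 c' χ j d - Typed.Sec12B.line020 c' χ j d‖ ≤ C * bigT D ^ (-c) ∧
      ‖Typed.Sec12B.line020 c' χ j d -
          deriv χ.LFunction 1 * (((d : ℝ) / P1pp D : ℝ) : ℂ) ^ (-beta6 D) /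
              (Real.log (Skeleton.P1 D) : ℂ) *
            (-1 + (beta6 D - betaJ c' D j) * (Real.log ((d : ℝ) / P1pp D) : ℂ))‖ ≤
        C * (ell D ^ 15)⁻¹)
    (hj : j ∈ ({1, 2, 3} : Finset ℕ)) (hn : 1 ≤ n) (hlo : P1pp D < n) (hhi : (n : ℝ) < Skeleton.P2 D) :
    ‖Typed.Sec12B.sum121 c' χ j n -
        deriv χ.LFunction 1 * (((n : ℝ) / P1pp D : ℝ) : ℂ) ^ (-beta6 D) /
            (Real.log (Skeleton.P1 D) : ℂ) *
          (-1 + (beta6 D - betaJ c' D j) * (Real.log ((n : ℝ) / P1pp D) : ℂ))‖ ≤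
      C * bigT D ^ (-c) + C * (ell D ^ 15)⁻¹ := by
  obtain ⟨h1, h2⟩ := h020 j hj n hn hlo hhi
  exact (norm_sub_le_norm_sub_add_norm_sub _ _ _).trans (add_le_add h1 h2)

end MLayer

/-! ## Part F6. Assembly on the sub-range `P″₁ < n < P₃` (both `ϰ̄₃`- and `ϰ̄₂`-parts present) -/

section SixAssembly

variable (c' : ℝ) {D : ℕ} [NeZero D] (χ : DirichletCharacter ℂ D)

/-- **The range assembly on `P″₁ < n < P₃`.** With the exact Lemma 12.1 body (`h020`, constant `C₁`,
`T^{−c} ≤ 𝓛⁻¹⁵`), the relative Lemma 8.4 (body `h84`, `C₂`) and the absolute logarithmic mean of `ξ₀ⱼ`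
(body `h3`, `C₃`): the re-indexed range sum minus the collapsed main term is bounded by the weighted
main-range (`n < P₃/T`) and window (`P₃/T ≤ n < P₃`) contributions of `range_assembly_bound₃` — in the
SAME shape as `Ranges1422.mid_assembly_le` (with its `C₁` read as `2C₁`).
[cite: Zhang2022LandauSiegel, §12 p. 73; §10 pp. 59–60] -/
theorem six_assembly_le (hℓ4 : 4 ≤ ell D) (hq : χ.IsQuadratic) (hp : χ.IsPrimitive)
    (hc5 : 5 * |c'| * alpha D * ell D ≤ 1) {c C₁ C₂ C₃ : ℝ} (hC₁ : 0 ≤ C₁) (hC₂ : 0 ≤ C₂)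
    (hC₃ : 0 ≤ C₃) (hTc : bigT D ^ (-c) ≤ (ell D ^ 15)⁻¹)
    (h020 : ∀ j ∈ ({1, 2, 3} : Finset ℕ), ∀ d : ℕ, 1 ≤ d → P1pp D < d → (d : ℝ) < Skeleton.P2 D →
      ‖Typed.Sec12B.sum121 c' χ j d - Typed.Sec12B.line020 c' χ j d‖ ≤ C₁ * bigT D ^ (-c) ∧
      ‖Typed.Sec12B.line020 c' χ j d -
          deriv χ.LFunction 1 * (((d : ℝ) / P1pp D : ℝ) : ℂ) ^ (-beta6 D) /
              (Real.log (Skeleton.P1 D) : ℂ) *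
            (-1 + (beta6 D - betaJ c' D j) * (Real.log ((d : ℝ) / P1pp D) : ℂ))‖ ≤
        C₁ * (ell D ^ 15)⁻¹)
    (h84 : ∀ j ∈ ({1, 2, 3} : Finset ℕ), ∀ μ ∈ ({6, 7} : Finset ℕ), ∀ d r : ℕ, 1 ≤ d → 1 ≤ r →
      ((d * r : ℕ) : ℝ) < bigP D / bigT D ^ 2 → ∀ y : ℝ, bigT D < y → y < bigP D →
        ‖(∑ n ∈ Finset.Ico 1 ⌈y⌉₊, χ (n : ZMod D) * xiZero c' D j n d r / (n : ℂ) *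
              ((y / n : ℝ) : ℂ) ^ (-betaMu D μ) * (Real.log (y / n) : ℂ)) -
            deriv χ.LFunction 1 * PiW χ d r * frakgW c' D j μ y‖ ≤
          C₂ * (ell D ^ 6)⁻¹ * (∏ q ∈ (d * r).primeFactors, (1 - (q : ℝ)⁻¹)⁻¹) ^ 2)
    (h3 : ∀ j ∈ ({1, 2, 3} : Finset ℕ), ∀ d r : ℕ, 1 ≤ d → 1 ≤ r →
      ((d * r : ℕ) : ℝ) < Skeleton.P1 D → ∀ x : ℝ, 1 ≤ x → x ≤ bigT D →
        ∑ n ∈ Finset.Ico 1 ⌈x⌉₊, ‖xiZero c' D j n d r‖ / n ≤ C₃ * ell D * (1 + Real.log x) ^ 3)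
    {j : ℕ} (hj : j ∈ ({1, 2, 3} : Finset ℕ)) :
    ‖(∑ n ∈ (Finset.Ico 1 (Nsupp D)).filter
          (fun n : ℕ => P1pp D < n ∧ (n : ℝ) < Skeleton.P3 D),
        ∑ r ∈ n.divisors,
          (if Squarefree r then
            (‖χ (n : ZMod D)‖ : ℂ) * lamZero c' D j n / (n : ℂ) / (Nat.totient r : ℂ) *
              Typed.Sec12B.sum121 c' χ j n * nSum22 c' χ j (n / r) r else 0)) -
      ∑ n ∈ (Finset.Ico 1 (Nsupp D)).filter
          (fun n : ℕ => P1pp D < n ∧ (n : ℝ) < Skeleton.P3 D),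
        (‖χ (n : ZMod D)‖ : ℂ) * lamZero c' D j n / (n : ℂ) * ((n : ℂ) / (Nat.totient n : ℂ)) *
          (deriv χ.LFunction 1 * (((n : ℝ) / P1pp D : ℝ) : ℂ) ^ (-beta6 D) /
                (Real.log (Skeleton.P1 D) : ℂ) *
              (-1 + (beta6 D - betaJ c' D j) * (Real.log ((n : ℝ) / P1pp D) : ℂ)) *
            deriv χ.LFunction 1 *
            (iota3 * (Real.log (Skeleton.P3 D) : ℂ)⁻¹ * frakgW c' D j 6 (Skeleton.P3 D / n) +
              iota4 * (Real.log (Skeleton.P2 D) : ℂ)⁻¹ * frakgW c' D j 7 (Skeleton.P2 D / n)))‖ ≤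
      (∑ n ∈ ((Finset.Ico 1 (Nsupp D)).filter
          (fun n : ℕ => P1pp D < n ∧ (n : ℝ) < Skeleton.P3 D)).filter
            (fun n : ℕ => (n : ℝ) < Skeleton.P3 D / bigT D),
          ‖(‖χ (n : ZMod D)‖ : ℂ) * lamZero c' D j n / (n : ℂ)‖ * ((n : ℝ) / Nat.totient n) ^ 3) *
          ((28000 * Real.exp (9 / 2) * (ell D ^ 7)⁻¹ +
                (2 * C₁ + 2000 * Real.exp (9 / 2) * (4 * π) * 520) * (ell D ^ 15)⁻¹) *
              ((‖iota3‖ / Real.log (Skeleton.P3 D) + ‖iota4‖ / Real.log (Skeleton.P2 D)) *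
                (C₂ * (ell D ^ 6)⁻¹)) +
            (2 * C₁ + 2000 * Real.exp (9 / 2) * (4 * π) * 520) * (ell D ^ 15)⁻¹ *
              ‖deriv χ.LFunction 1‖ *
              (146 * (‖iota3‖ / Real.log (Skeleton.P3 D) + ‖iota4‖ / Real.log (Skeleton.P2 D)))) +
        (∑ n ∈ ((Finset.Ico 1 (Nsupp D)).filter
          (fun n : ℕ => P1pp D < n ∧ (n : ℝ) < Skeleton.P3 D)).filter
            (fun n : ℕ => ¬ ((n : ℝ) < Skeleton.P3 D / bigT D)),
          ‖(‖χ (n : ZMod D)‖ : ℂ) * lamZero c' D j n / (n : ℂ)‖ * ((n : ℝ) / Nat.totient n) ^ 3) *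
          ((2 * C₁ + 28000 * Real.exp (9 / 2)) * (ell D ^ 7)⁻¹ *
              ((‖iota3‖ / Real.log (Skeleton.P3 D) + ‖iota4‖ / Real.log (Skeleton.P2 D)) *
                (584 * Real.exp (9 / 2) * ell D ^ 2 + C₂ * (ell D ^ 6)⁻¹ +
                  C₃ * ell D * (1 + Real.log (bigT D)) ^ 3 * Real.log (bigT D))) +
            28000 * Real.exp (9 / 2) * (ell D ^ 7)⁻¹ * ‖deriv χ.LFunction 1‖ *
              (146 * (‖iota3‖ / Real.log (Skeleton.P3 D) + ‖iota4‖ / Real.log (Skeleton.P2 D)))) := by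
  classical
  have hℓ : 3 ≤ ell D := by linarith
  have hℓ0 : 0 < ell D := by linarith
  have hℓ1 : 1 ≤ ell D := by linarith
  have hℓ4' : 4 ≤ Real.log D := by simpa only [ell] using hℓ4
  obtain ⟨h2, hab, hb5, h5504, h504, h5P, hN⟩ := range_facts (D := D) hℓ
  obtain ⟨h496, -, hP2le, hP3def', -⟩ := window_facts (D := D) hℓ
  have hP := bigP_pos D
  have hT := bigT_pos D
  have hT1 := Sec12D.one_le_bigT D
  have h498T := rpow498_div_T_le (D := D) hℓ4
  have hP3def : Skeleton.P3 D = bigP D ^ (0.498 : ℝ) := rfl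
  have hP3P2 : Skeleton.P3 D ≤ Skeleton.P2 D := Sec12D.P3_le_P2 hℓ4'
  have h15_7 : (ell D ^ 15)⁻¹ ≤ (ell D ^ 7)⁻¹ := by
    rw [inv_le_inv₀ (by positivity) (by positivity)]; exact pow_le_pow_right₀ hℓ1 (by norm_num)
  set K₀ : ℝ := 2000 * Real.exp (9 / 2) * (4 * π) * 520 with hK₀
  have hK₀0 : 0 ≤ K₀ := by positivity
  set S := (Finset.Ico 1 (Nsupp D)).filter
      (fun n : ℕ => P1pp D < n ∧ (n : ℝ) < Skeleton.P3 D) with hSdef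
  have memS : ∀ n ∈ S, 1 ≤ n ∧ P1pp D < (n : ℝ) ∧ (n : ℝ) < Skeleton.P3 D := by
    intro n hn
    rw [hSdef, Finset.mem_filter, Finset.mem_Ico] at hn
    exact ⟨hn.1.1, hn.2.1, hn.2.2⟩
  have hS0 : ∀ n ∈ S, n ≠ 0 := fun n hn => by have := (memS n hn).1; omega
  -- the constants
  have hR0 : 0 ≤ ‖iota3‖ / Real.log (Skeleton.P3 D) + ‖iota4‖ / Real.log (Skeleton.P2 D) :=
    iotaR_nonneg hℓ
  refine range_assembly_bound₃ hS0
    (fun n : ℕ => (n : ℝ) < Skeleton.P3 D / bigT D)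
    (fun n => (‖χ (n : ZMod D)‖ : ℂ) * lamZero c' D j n / (n : ℂ))
    (fun n => Typed.Sec12B.sum121 c' χ j n)
    (fun n => deriv χ.LFunction 1 * (((n : ℝ) / P1pp D : ℝ) : ℂ) ^ (-beta6 D) /
        (Real.log (Skeleton.P1 D) : ℂ) *
      (-1 + (beta6 D - betaJ c' D j) * (Real.log ((n : ℝ) / P1pp D) : ℂ)))
    (fun n => iota3 * (Real.log (Skeleton.P3 D) : ℂ)⁻¹ * frakgW c' D j 6 (Skeleton.P3 D / n) +
      iota4 * (Real.log (Skeleton.P2 D) : ℂ)⁻¹ * frakgW c' D j 7 (Skeleton.P2 D / n))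
    (fun d r => nSum22 c' χ j d r) (fun d r => PiW χ d r) (deriv χ.LFunction 1)
    (by positivity) (by positivity) (by positivity) ?_ ?_ ?_ ?_ ?_ ?_ ?_
  · -- hPi: (8.10)
    intro n hn _
    exact Section8FrontEnd810.eq810_holds D χ hq n (hS0 n hn)
  · -- hM: Lemma 12.1 (exact reading) on the whole range
    intro n hn _
    obtain ⟨hn1, hlo, hhi⟩ := memS n hn
    have key := norm_sum121_sub_M0_le c' χ j h020 hj hn1 hlo (lt_of_lt_of_le hhi hP3P2)
    refine key.trans ?_
    have h15 : 0 ≤ (ell D ^ 15)⁻¹ := by positivity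
    calc C₁ * bigT D ^ (-c) + C₁ * (ell D ^ 15)⁻¹ ≤ C₁ * (ell D ^ 15)⁻¹ + C₁ * (ell D ^ 15)⁻¹ := by
          gcongr
      _ = (2 * C₁) * (ell D ^ 15)⁻¹ := by ring
      _ ≤ (2 * C₁ + K₀) * (ell D ^ 15)⁻¹ := by gcongr; linarith
  · -- hM₀
    intro n hn
    obtain ⟨-, hlo, hhi⟩ := memS n hn
    exact norm_M0_le c' χ hℓ hp hc5 j hlo (lt_of_lt_of_le hhi hP3P2)
  · -- hMW: `‖M‖ ≤ ‖M₀‖ + ‖M − M₀‖`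
    intro n hn _
    obtain ⟨hn1, hlo, hhi⟩ := memS n hn
    have hhi2 := lt_of_lt_of_le hhi hP3P2
    have k1 := norm_sum121_sub_M0_le c' χ j h020 hj hn1 hlo hhi2
    have k2 := norm_M0_le c' χ hℓ hp hc5 j hlo hhi2
    have k3 := norm_le_norm_add_norm_sub' (Typed.Sec12B.sum121 c' χ j n)
      (deriv χ.LFunction 1 * (((n : ℝ) / P1pp D : ℝ) : ℂ) ^ (-beta6 D) /
          (Real.log (Skeleton.P1 D) : ℂ) *
        (-1 + (beta6 D - betaJ c' D j) * (Real.log ((n : ℝ) / P1pp D) : ℂ)))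
    have h15 : 0 ≤ (ell D ^ 15)⁻¹ := by positivity
    have hTc' : C₁ * bigT D ^ (-c) ≤ C₁ * (ell D ^ 7)⁻¹ :=
      mul_le_mul_of_nonneg_left (hTc.trans h15_7) hC₁
    have h15' : C₁ * (ell D ^ 15)⁻¹ ≤ C₁ * (ell D ^ 7)⁻¹ := mul_le_mul_of_nonneg_left h15_7 hC₁
    calc ‖Typed.Sec12B.sum121 c' χ j n‖
        ≤ 28000 * Real.exp (9 / 2) * (ell D ^ 7)⁻¹ + (C₁ * bigT D ^ (-c) + C₁ * (ell D ^ 15)⁻¹) := by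
          linarith
      _ ≤ 28000 * Real.exp (9 / 2) * (ell D ^ 7)⁻¹ + (C₁ * (ell D ^ 7)⁻¹ + C₁ * (ell D ^ 7)⁻¹) := by
          gcongr
      _ = (2 * C₁ + 28000 * Real.exp (9 / 2)) * (ell D ^ 7)⁻¹ := by ring
  · -- hG
    intro n hn
    obtain ⟨hn1, -, hhi⟩ := memS n hn
    exact norm_G_le c' hℓ hc5 j (by exact_mod_cast hn1) (by rw [hP3def] at hhi; linarith)
  · -- hN: the relative Lemma 8.4, both parts in range
    intro n hn hmain r hr hsq
    obtain ⟨hn1, hlo, hhi⟩ := memS n hn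
    have hrd : r ∣ n := Nat.dvd_of_mem_divisors hr
    have hr0 : r ≠ 0 := Nat.pos_iff_ne_zero.mp (Nat.pos_of_mem_divisors hr)
    have hr1 : 1 ≤ r := Nat.one_le_iff_ne_zero.mpr hr0
    have hdr : n / r * r = n := Nat.div_mul_cancel hrd
    have hd1 : 1 ≤ n / r := Nat.div_pos (Nat.le_of_dvd (by omega) hrd) (by omega)
    have hcast : ((n / r * r : ℕ) : ℝ) = n := by rw [hdr]
    have hnP : (n : ℝ) < bigP D / bigT D ^ 2 := by
      rw [hP3def] at hhi; linarith
    have hdrP : ((n / r * r : ℕ) : ℝ) < bigP D / bigT D ^ 2 := by rw [hcast]; exact hnP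
    have hn0r : (0 : ℝ) < n := by exact_mod_cast (by omega : 0 < n)
    have hmain' : (n : ℝ) < bigP D ^ (0.498 : ℝ) / bigT D := by rw [← hP3def]; exact hmain
    -- the two Lemma 8.4 instances
    have hy6T : bigT D < Skeleton.P3 D / ((n / r * r : ℕ) : ℝ) := by
      rw [hcast, lt_div_iff₀ hn0r]
      have := (lt_div_iff₀ hT).mp hmain
      linarith
    have hy6P : Skeleton.P3 D / ((n / r * r : ℕ) : ℝ) < bigP D := by
      rw [hcast]
      exact lt_of_le_of_lt (div_le_self (by rw [hP3def]; exact (bigP_rpow_pos D _).le)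
        (by exact_mod_cast hn1)) (P3_lt_bigP hℓ)
    have hy7T : bigT D < Skeleton.P2 D / ((n / r * r : ℕ) : ℝ) := by
      rw [hcast, Skeleton.P2, lt_div_iff₀ hn0r]
      have h1 : (n : ℝ) < bigP D ^ (0.5 : ℝ) / bigT D ^ 11 := lt_of_lt_of_le hmain' h498T
      rw [lt_div_iff₀ (pow_pos hT 11)] at h1
      rw [lt_div_iff₀ (pow_pos hT 10)]
      calc bigT D * n * bigT D ^ 10 = n * bigT D ^ 11 := by ring
        _ < bigP D ^ (0.5 : ℝ) := h1
    have hy7P : Skeleton.P2 D / ((n / r * r : ℕ) : ℝ) < bigP D := by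
      rw [hcast]
      exact lt_of_le_of_lt (div_le_self (by linarith [one_lt_P2 (D := D) hℓ]) (by exact_mod_cast hn1))
        (P2_lt_bigP hℓ)
    have i6 := h84 j hj 6 (by simp) (n / r) r hd1 hr1 hdrP _ hy6T hy6P
    have i7 := h84 j hj 7 (by simp) (n / r) r hd1 hr1 hdrP _ hy7T hy7P
    have key := norm_nSum22_sub_main_le c' χ hℓ j hd1 hr1 i6 i7
    rw [hdr] at key
    exact key.trans (le_of_eq (by ring))
  · -- hW: window bound
    intro n hn _ r hr hsq
    obtain ⟨hn1, hlo, hhi⟩ := memS n hn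
    have hrd : r ∣ n := Nat.dvd_of_mem_divisors hr
    have hr0 : r ≠ 0 := Nat.pos_iff_ne_zero.mp (Nat.pos_of_mem_divisors hr)
    have hr1 : 1 ≤ r := Nat.one_le_iff_ne_zero.mpr hr0
    have hdr : n / r * r = n := Nat.div_mul_cancel hrd
    have hd1 : 1 ≤ n / r := Nat.div_pos (Nat.le_of_dvd (by omega) hrd) (by omega)
    have hcast : ((n / r * r : ℕ) : ℝ) = n := by rw [hdr]
    have hhi' : (n : ℝ) < bigP D ^ (0.498 : ℝ) := by rw [← hP3def]; exact hhi
    have hdrP2 : ((n / r * r : ℕ) : ℝ) < bigP D / bigT D ^ 2 := by rw [hcast]; linarith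
    have hdrP : ((n / r * r : ℕ) : ℝ) ≤ bigP D := by rw [hcast]; linarith
    have hdrP1 : ((n / r * r : ℕ) : ℝ) < Skeleton.P1 D := by rw [hcast, Skeleton.P1]; linarith
    have hy6P : Skeleton.P3 D / ((n / r * r : ℕ) : ℝ) < bigP D := by
      rw [hcast]
      exact lt_of_le_of_lt (div_le_self (by rw [hP3def]; exact (bigP_rpow_pos D _).le)
        (by exact_mod_cast hn1)) (P3_lt_bigP hℓ)
    have hy7P : Skeleton.P2 D / ((n / r * r : ℕ) : ℝ) < bigP D := by
      rw [hcast]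
      exact lt_of_le_of_lt (div_le_self (by linarith [one_lt_P2 (D := D) hℓ]) (by exact_mod_cast hn1))
        (P2_lt_bigP hℓ)
    have key := norm_nSum22_window_le c' χ hℓ hp hc5 hC₂ hC₃ j hd1 hr1 hdrP
      (fun hT6 => h84 j hj 6 (by simp) (n / r) r hd1 hr1 hdrP2 _ hT6 hy6P)
      (fun hT7 => h84 j hj 7 (by simp) (n / r) r hd1 hr1 hdrP2 _ hT7 hy7P)
      (fun x hx1 hxT => h3 j hj (n / r) r hd1 hr1 hdrP1 x hx1 hxT)
    rw [hdr] at key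
    exact key.trans (le_of_eq (by ring))

end SixAssembly

/-! ## Part F7. Assembly on the sub-range `P₃ ≤ n < P₂` (only the `ϰ̄₂`-part of the `n`-sum survives) -/

section SevenAssembly

variable (c' : ℝ) {D : ℕ} [NeZero D] (χ : DirichletCharacter ℂ D)

/-- **The range assembly on `P″₁ < n < P₂`, `n ≥ P₃`.** As `six_assembly_le`, with the `ϰ̄₃`-part of the
`n`-sum empty (`Ranges1422.nSum22_eq_S84_top`) and the Lemma-8.4 main range `n < P^{0.5}T^{−11} = P₂/T`
— in the SAME shape as `Ranges1422.top_assembly_le` (with its `C₁` read as `2C₁`).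
[cite: Zhang2022LandauSiegel, §12 p. 73; §10 p. 60] -/
theorem seven_assembly_le (hℓ4 : 4 ≤ ell D) (hq : χ.IsQuadratic) (hp : χ.IsPrimitive)
    (hc5 : 5 * |c'| * alpha D * ell D ≤ 1) {c C₁ C₂ C₃ : ℝ} (hC₁ : 0 ≤ C₁) (hC₂ : 0 ≤ C₂)
    (hC₃ : 0 ≤ C₃) (hTc : bigT D ^ (-c) ≤ (ell D ^ 15)⁻¹)
    (h020 : ∀ j ∈ ({1, 2, 3} : Finset ℕ), ∀ d : ℕ, 1 ≤ d → P1pp D < d → (d : ℝ) < Skeleton.P2 D →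
      ‖Typed.Sec12B.sum121 c' χ j d - Typed.Sec12B.line020 c' χ j d‖ ≤ C₁ * bigT D ^ (-c) ∧
      ‖Typed.Sec12B.line020 c' χ j d -
          deriv χ.LFunction 1 * (((d : ℝ) / P1pp D : ℝ) : ℂ) ^ (-beta6 D) /
              (Real.log (Skeleton.P1 D) : ℂ) *
            (-1 + (beta6 D - betaJ c' D j) * (Real.log ((d : ℝ) / P1pp D) : ℂ))‖ ≤
        C₁ * (ell D ^ 15)⁻¹)
    (h84 : ∀ j ∈ ({1, 2, 3} : Finset ℕ), ∀ μ ∈ ({6, 7} : Finset ℕ), ∀ d r : ℕ, 1 ≤ d → 1 ≤ r →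
      ((d * r : ℕ) : ℝ) < bigP D / bigT D ^ 2 → ∀ y : ℝ, bigT D < y → y < bigP D →
        ‖(∑ n ∈ Finset.Ico 1 ⌈y⌉₊, χ (n : ZMod D) * xiZero c' D j n d r / (n : ℂ) *
              ((y / n : ℝ) : ℂ) ^ (-betaMu D μ) * (Real.log (y / n) : ℂ)) -
            deriv χ.LFunction 1 * PiW χ d r * frakgW c' D j μ y‖ ≤
          C₂ * (ell D ^ 6)⁻¹ * (∏ q ∈ (d * r).primeFactors, (1 - (q : ℝ)⁻¹)⁻¹) ^ 2)
    (h3 : ∀ j ∈ ({1, 2, 3} : Finset ℕ), ∀ d r : ℕ, 1 ≤ d → 1 ≤ r →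
      ((d * r : ℕ) : ℝ) < Skeleton.P1 D → ∀ x : ℝ, 1 ≤ x → x ≤ bigT D →
        ∑ n ∈ Finset.Ico 1 ⌈x⌉₊, ‖xiZero c' D j n d r‖ / n ≤ C₃ * ell D * (1 + Real.log x) ^ 3)
    {j : ℕ} (hj : j ∈ ({1, 2, 3} : Finset ℕ)) :
    ‖(∑ n ∈ ((Finset.Ico 1 (Nsupp D)).filter
          (fun n : ℕ => P1pp D < n ∧ (n : ℝ) < Skeleton.P2 D)).filter
            (fun n : ℕ => ¬ ((n : ℝ) < Skeleton.P3 D)),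
        ∑ r ∈ n.divisors,
          (if Squarefree r then
            (‖χ (n : ZMod D)‖ : ℂ) * lamZero c' D j n / (n : ℂ) / (Nat.totient r : ℂ) *
              Typed.Sec12B.sum121 c' χ j n * nSum22 c' χ j (n / r) r else 0)) -
      ∑ n ∈ ((Finset.Ico 1 (Nsupp D)).filter
          (fun n : ℕ => P1pp D < n ∧ (n : ℝ) < Skeleton.P2 D)).filter
            (fun n : ℕ => ¬ ((n : ℝ) < Skeleton.P3 D)),
        (‖χ (n : ZMod D)‖ : ℂ) * lamZero c' D j n / (n : ℂ) * ((n : ℂ) / (Nat.totient n : ℂ)) *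
          (deriv χ.LFunction 1 * (((n : ℝ) / P1pp D : ℝ) : ℂ) ^ (-beta6 D) /
                (Real.log (Skeleton.P1 D) : ℂ) *
              (-1 + (beta6 D - betaJ c' D j) * (Real.log ((n : ℝ) / P1pp D) : ℂ)) *
            deriv χ.LFunction 1 *
            (iota4 * (Real.log (Skeleton.P2 D) : ℂ)⁻¹ * frakgW c' D j 7 (Skeleton.P2 D / n)))‖ ≤
      (∑ n ∈ (((Finset.Ico 1 (Nsupp D)).filter
          (fun n : ℕ => P1pp D < n ∧ (n : ℝ) < Skeleton.P2 D)).filter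
            (fun n : ℕ => ¬ ((n : ℝ) < Skeleton.P3 D))).filter
            (fun n : ℕ => (n : ℝ) < bigP D ^ (0.5 : ℝ) / bigT D ^ 11),
          ‖(‖χ (n : ZMod D)‖ : ℂ) * lamZero c' D j n / (n : ℂ)‖ * ((n : ℝ) / Nat.totient n) ^ 3) *
          ((28000 * Real.exp (9 / 2) * (ell D ^ 7)⁻¹ +
                (2 * C₁ + 2000 * Real.exp (9 / 2) * (4 * π) * 520) * (ell D ^ 15)⁻¹) *
              ((‖iota3‖ / Real.log (Skeleton.P3 D) + ‖iota4‖ / Real.log (Skeleton.P2 D)) *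
                (C₂ * (ell D ^ 6)⁻¹)) +
            (2 * C₁ + 2000 * Real.exp (9 / 2) * (4 * π) * 520) * (ell D ^ 15)⁻¹ *
              ‖deriv χ.LFunction 1‖ *
              (146 * (‖iota3‖ / Real.log (Skeleton.P3 D) + ‖iota4‖ / Real.log (Skeleton.P2 D)))) +
        (∑ n ∈ (((Finset.Ico 1 (Nsupp D)).filter
          (fun n : ℕ => P1pp D < n ∧ (n : ℝ) < Skeleton.P2 D)).filter
            (fun n : ℕ => ¬ ((n : ℝ) < Skeleton.P3 D))).filter
            (fun n : ℕ => ¬ ((n : ℝ) < bigP D ^ (0.5 : ℝ) / bigT D ^ 11)),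
          ‖(‖χ (n : ZMod D)‖ : ℂ) * lamZero c' D j n / (n : ℂ)‖ * ((n : ℝ) / Nat.totient n) ^ 3) *
          ((2 * C₁ + 28000 * Real.exp (9 / 2)) * (ell D ^ 7)⁻¹ *
              ((‖iota3‖ / Real.log (Skeleton.P3 D) + ‖iota4‖ / Real.log (Skeleton.P2 D)) *
                (584 * Real.exp (9 / 2) * ell D ^ 2 + C₂ * (ell D ^ 6)⁻¹ +
                  C₃ * ell D * (1 + Real.log (bigT D)) ^ 3 * Real.log (bigT D))) +
            28000 * Real.exp (9 / 2) * (ell D ^ 7)⁻¹ * ‖deriv χ.LFunction 1‖ *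
              (146 * (‖iota3‖ / Real.log (Skeleton.P3 D) + ‖iota4‖ / Real.log (Skeleton.P2 D)))) := by
  classical
  have hℓ : 3 ≤ ell D := by linarith
  have hℓ0 : 0 < ell D := by linarith
  have hℓ1 : 1 ≤ ell D := by linarith
  have hℓ4' : 4 ≤ Real.log D := by simpa only [ell] using hℓ4
  obtain ⟨h2, hab, hb5, h5504, h504, h5P, hN⟩ := range_facts (D := D) hℓ
  obtain ⟨h496, -, hP2le, -, hP2eq⟩ := window_facts (D := D) hℓ
  have hP := bigP_pos D
  have hT := bigT_pos D
  have hT1 := Sec12D.one_le_bigT D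
  have hP3def : Skeleton.P3 D = bigP D ^ (0.498 : ℝ) := rfl
  have hP2pos : 0 < Skeleton.P2 D := by linarith [one_lt_P2 (D := D) hℓ]
  have h15_7 : (ell D ^ 15)⁻¹ ≤ (ell D ^ 7)⁻¹ := by
    rw [inv_le_inv₀ (by positivity) (by positivity)]; exact pow_le_pow_right₀ hℓ1 (by norm_num)
  set K₀ : ℝ := 2000 * Real.exp (9 / 2) * (4 * π) * 520 with hK₀
  have hK₀0 : 0 ≤ K₀ := by positivity
  set S := ((Finset.Ico 1 (Nsupp D)).filter
      (fun n : ℕ => P1pp D < n ∧ (n : ℝ) < Skeleton.P2 D)).filter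
        (fun n : ℕ => ¬ ((n : ℝ) < Skeleton.P3 D)) with hSdef
  have memS : ∀ n ∈ S, 1 ≤ n ∧ P1pp D < (n : ℝ) ∧ (n : ℝ) < Skeleton.P2 D ∧
      Skeleton.P3 D ≤ (n : ℝ) := by
    intro n hn
    rw [hSdef, Finset.mem_filter, Finset.mem_filter, Finset.mem_Ico] at hn
    exact ⟨hn.1.1.1, hn.1.2.1, hn.1.2.2, not_lt.mp hn.2⟩
  have hS0 : ∀ n ∈ S, n ≠ 0 := fun n hn => by have := (memS n hn).1; omega
  have hR0 : 0 ≤ ‖iota3‖ / Real.log (Skeleton.P3 D) + ‖iota4‖ / Real.log (Skeleton.P2 D) :=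
    iotaR_nonneg hℓ
  refine range_assembly_bound₃ hS0
    (fun n : ℕ => (n : ℝ) < bigP D ^ (0.5 : ℝ) / bigT D ^ 11)
    (fun n => (‖χ (n : ZMod D)‖ : ℂ) * lamZero c' D j n / (n : ℂ))
    (fun n => Typed.Sec12B.sum121 c' χ j n)
    (fun n => deriv χ.LFunction 1 * (((n : ℝ) / P1pp D : ℝ) : ℂ) ^ (-beta6 D) /
        (Real.log (Skeleton.P1 D) : ℂ) *
      (-1 + (beta6 D - betaJ c' D j) * (Real.log ((n : ℝ) / P1pp D) : ℂ)))
    (fun n => iota4 * (Real.log (Skeleton.P2 D) : ℂ)⁻¹ * frakgW c' D j 7 (Skeleton.P2 D / n))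
    (fun d r => nSum22 c' χ j d r) (fun d r => PiW χ d r) (deriv χ.LFunction 1)
    (by positivity) (by positivity) (by positivity) ?_ ?_ ?_ ?_ ?_ ?_ ?_
  · -- hPi: (8.10)
    intro n hn _
    exact Section8FrontEnd810.eq810_holds D χ hq n (hS0 n hn)
  · -- hM: Lemma 12.1 (exact reading) on the whole range
    intro n hn _
    obtain ⟨hn1, hlo, hhi, -⟩ := memS n hn
    have key := norm_sum121_sub_M0_le c' χ j h020 hj hn1 hlo hhi
    refine key.trans ?_
    calc C₁ * bigT D ^ (-c) + C₁ * (ell D ^ 15)⁻¹ ≤ C₁ * (ell D ^ 15)⁻¹ + C₁ * (ell D ^ 15)⁻¹ := by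
          gcongr
      _ = (2 * C₁) * (ell D ^ 15)⁻¹ := by ring
      _ ≤ (2 * C₁ + K₀) * (ell D ^ 15)⁻¹ := by gcongr; linarith
  · -- hM₀
    intro n hn
    obtain ⟨-, hlo, hhi, -⟩ := memS n hn
    exact norm_M0_le c' χ hℓ hp hc5 j hlo hhi
  · -- hMW
    intro n hn _
    obtain ⟨hn1, hlo, hhi, -⟩ := memS n hn
    have k1 := norm_sum121_sub_M0_le c' χ j h020 hj hn1 hlo hhi
    have k2 := norm_M0_le c' χ hℓ hp hc5 j hlo hhi
    have k3 := norm_le_norm_add_norm_sub' (Typed.Sec12B.sum121 c' χ j n)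
      (deriv χ.LFunction 1 * (((n : ℝ) / P1pp D : ℝ) : ℂ) ^ (-beta6 D) /
          (Real.log (Skeleton.P1 D) : ℂ) *
        (-1 + (beta6 D - betaJ c' D j) * (Real.log ((n : ℝ) / P1pp D) : ℂ)))
    have hTc' : C₁ * bigT D ^ (-c) ≤ C₁ * (ell D ^ 7)⁻¹ :=
      mul_le_mul_of_nonneg_left (hTc.trans h15_7) hC₁
    have h15' : C₁ * (ell D ^ 15)⁻¹ ≤ C₁ * (ell D ^ 7)⁻¹ := mul_le_mul_of_nonneg_left h15_7 hC₁
    calc ‖Typed.Sec12B.sum121 c' χ j n‖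
        ≤ 28000 * Real.exp (9 / 2) * (ell D ^ 7)⁻¹ + (C₁ * bigT D ^ (-c) + C₁ * (ell D ^ 15)⁻¹) := by
          linarith
      _ ≤ 28000 * Real.exp (9 / 2) * (ell D ^ 7)⁻¹ + (C₁ * (ell D ^ 7)⁻¹ + C₁ * (ell D ^ 7)⁻¹) := by
          gcongr
      _ = (2 * C₁ + 28000 * Real.exp (9 / 2)) * (ell D ^ 7)⁻¹ := by ring
  · -- hG
    intro n hn
    obtain ⟨hn1, -, hhi, -⟩ := memS n hn
    exact norm_Gtop_le c' hℓ hc5 j (by exact_mod_cast hn1) (by linarith)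
  · -- hN: the relative Lemma 8.4 (μ = 7) in range; the `ϰ₃` part vanishes
    intro n hn hmain r hr hsq
    obtain ⟨hn1, hlo, hhi, htop⟩ := memS n hn
    have hrd : r ∣ n := Nat.dvd_of_mem_divisors hr
    have hr0 : r ≠ 0 := Nat.pos_iff_ne_zero.mp (Nat.pos_of_mem_divisors hr)
    have hr1 : 1 ≤ r := Nat.one_le_iff_ne_zero.mpr hr0
    have hdr : n / r * r = n := Nat.div_mul_cancel hrd
    have hd1 : 1 ≤ n / r := Nat.div_pos (Nat.le_of_dvd (by omega) hrd) (by omega)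
    have hcast : ((n / r * r : ℕ) : ℝ) = n := by rw [hdr]
    have hdrP : ((n / r * r : ℕ) : ℝ) < bigP D / bigT D ^ 2 := by rw [hcast]; linarith
    have hn0r : (0 : ℝ) < n := by exact_mod_cast (by omega : 0 < n)
    have htop' : Skeleton.P3 D ≤ ((n / r * r : ℕ) : ℝ) := by rw [hcast]; exact htop
    have hy7T : bigT D < Skeleton.P2 D / ((n / r * r : ℕ) : ℝ) := by
      rw [hcast, Skeleton.P2, lt_div_iff₀ hn0r]
      have h1 : (n : ℝ) < bigP D ^ (0.5 : ℝ) / bigT D ^ 11 := hmain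
      rw [lt_div_iff₀ (pow_pos hT 11)] at h1
      rw [lt_div_iff₀ (pow_pos hT 10)]
      calc bigT D * n * bigT D ^ 10 = n * bigT D ^ 11 := by ring
        _ < bigP D ^ (0.5 : ℝ) := h1
    have hy7P : Skeleton.P2 D / ((n / r * r : ℕ) : ℝ) < bigP D := by
      rw [hcast]
      exact lt_of_le_of_lt (div_le_self hP2pos.le (by exact_mod_cast hn1)) (P2_lt_bigP hℓ)
    have i7 := h84 j hj 7 (by simp) (n / r) r hd1 hr1 hdrP _ hy7T hy7P
    have key := norm_nSum22_sub_main_top_le c' χ hℓ j hd1 hr1 htop' hC₂ i7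
    rw [hdr] at key
    exact key.trans (le_of_eq (by ring))
  · -- hW: window bound
    intro n hn _ r hr hsq
    obtain ⟨hn1, hlo, hhi, -⟩ := memS n hn
    have hrd : r ∣ n := Nat.dvd_of_mem_divisors hr
    have hr0 : r ≠ 0 := Nat.pos_iff_ne_zero.mp (Nat.pos_of_mem_divisors hr)
    have hr1 : 1 ≤ r := Nat.one_le_iff_ne_zero.mpr hr0
    have hdr : n / r * r = n := Nat.div_mul_cancel hrd
    have hd1 : 1 ≤ n / r := Nat.div_pos (Nat.le_of_dvd (by omega) hrd) (by omega)
    have hcast : ((n / r * r : ℕ) : ℝ) = n := by rw [hdr]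
    have hdrP2 : ((n / r * r : ℕ) : ℝ) < bigP D / bigT D ^ 2 := by rw [hcast]; linarith
    have hdrP : ((n / r * r : ℕ) : ℝ) ≤ bigP D := by rw [hcast]; linarith
    have hdrP1 : ((n / r * r : ℕ) : ℝ) < Skeleton.P1 D := by rw [hcast, Skeleton.P1]; linarith
    have hy6P : Skeleton.P3 D / ((n / r * r : ℕ) : ℝ) < bigP D := by
      rw [hcast]
      exact lt_of_le_of_lt (div_le_self (by rw [hP3def]; exact (bigP_rpow_pos D _).le)
        (by exact_mod_cast hn1)) (P3_lt_bigP hℓ)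
    have hy7P : Skeleton.P2 D / ((n / r * r : ℕ) : ℝ) < bigP D := by
      rw [hcast]
      exact lt_of_le_of_lt (div_le_self hP2pos.le (by exact_mod_cast hn1)) (P2_lt_bigP hℓ)
    have key := norm_nSum22_window_le c' χ hℓ hp hc5 hC₂ hC₃ j hd1 hr1 hdrP
      (fun hT6 => h84 j hj 6 (by simp) (n / r) r hd1 hr1 hdrP2 _ hT6 hy6P)
      (fun hT7 => h84 j hj 7 (by simp) (n / r) r hd1 hr1 hdrP2 _ hT7 hy7P)
      (fun x hx1 hxT => h3 j hj (n / r) r hd1 hr1 hdrP1 x hx1 hxT)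
    rw [hdr] at key
    exact key.trans (le_of_eq (by ring))

end SevenAssembly

/-! ## Part G. Replacing `G` by the printed profiles `𝓖_{j6}(P^{0.498}/n)/(0.498 log P)`, `𝓖_{j7}(P^{0.5}/n)/(0.5 log P)` -/

section GSwap

variable (c' : ℝ) {D : ℕ} [NeZero D] (χ : DirichletCharacter ℂ D)

/-- **Profile swap on `P″₁ < n < P₃`**: replacing `G` by the printed profile costs
`≤ W·28000e^{9/2}𝓛⁻⁷·|L′(1,χ)|·10⁵𝓛^{1.1}𝓛⁻¹⁸` (`Ranges1422.norm_G_sub_Gpr_le`).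
[cite: Zhang2022LandauSiegel, §12 p. 73; §10 pp. 59–60] -/
theorem six_Gswap_le (hℓ4 : 4 ≤ ell D) (hp : χ.IsPrimitive) (hc5 : 5 * |c'| * alpha D * ell D ≤ 1)
    (j : ℕ) :
    ‖(∑ n ∈ (Finset.Ico 1 (Nsupp D)).filter
        (fun n : ℕ => P1pp D < n ∧ (n : ℝ) < Skeleton.P3 D),
      (‖χ (n : ZMod D)‖ : ℂ) * lamZero c' D j n / (n : ℂ) * ((n : ℂ) / (Nat.totient n : ℂ)) *
        (deriv χ.LFunction 1 * (((n : ℝ) / P1pp D : ℝ) : ℂ) ^ (-beta6 D) /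
              (Real.log (Skeleton.P1 D) : ℂ) *
            (-1 + (beta6 D - betaJ c' D j) * (Real.log ((n : ℝ) / P1pp D) : ℂ)) *
          deriv χ.LFunction 1 *
          (iota3 * (Real.log (Skeleton.P3 D) : ℂ)⁻¹ * frakgW c' D j 6 (Skeleton.P3 D / n) +
            iota4 * (Real.log (Skeleton.P2 D) : ℂ)⁻¹ * frakgW c' D j 7 (Skeleton.P2 D / n)))) -
      ∑ n ∈ (Finset.Ico 1 (Nsupp D)).filter
        (fun n : ℕ => P1pp D < n ∧ (n : ℝ) < Skeleton.P3 D),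
      (‖χ (n : ZMod D)‖ : ℂ) * lamZero c' D j n / (n : ℂ) * ((n : ℂ) / (Nat.totient n : ℂ)) *
        (deriv χ.LFunction 1 * (((n : ℝ) / P1pp D : ℝ) : ℂ) ^ (-beta6 D) /
              (Real.log (Skeleton.P1 D) : ℂ) *
            (-1 + (beta6 D - betaJ c' D j) * (Real.log ((n : ℝ) / P1pp D) : ℂ)) *
          deriv χ.LFunction 1 *
          ((iota3 / 0.498 * frakgW c' D j 6 (bigP D ^ (0.498 : ℝ) / n) +
              iota4 / 0.5 * frakgW c' D j 7 (bigP D ^ (0.5 : ℝ) / n)) / (Real.log (bigP D) : ℂ)))‖ ≤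
      (∑ n ∈ (Finset.Ico 1 (Nsupp D)).filter
        (fun n : ℕ => P1pp D < n ∧ (n : ℝ) < Skeleton.P3 D),
          ‖(‖χ (n : ZMod D)‖ : ℂ) * lamZero c' D j n / (n : ℂ)‖ * ((n : ℝ) / Nat.totient n) ^ 3) *
        (28000 * Real.exp (9 / 2) * (ell D ^ 7)⁻¹ * ‖deriv χ.LFunction 1‖ *
          (100000 * ell D ^ (1.1 : ℝ) * (ell D ^ 18)⁻¹)) := by
  have hℓ : 3 ≤ ell D := by linarith
  have hℓ0 : 0 < ell D := by linarith
  have hℓ4' : 4 ≤ Real.log D := by simpa only [ell] using hℓ4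
  have hP3P2 : Skeleton.P3 D ≤ Skeleton.P2 D := Sec12D.P3_le_P2 hℓ4'
  obtain ⟨-, -, hP2le, hP3def, -⟩ := window_facts (D := D) hℓ
  rw [← Finset.sum_sub_distrib, Finset.sum_mul]
  refine (norm_sum_le _ _).trans (Finset.sum_le_sum fun n hn => ?_)
  obtain ⟨hn', hlo, hhi⟩ := Finset.mem_filter.mp hn
  have hn1 : 1 ≤ n := (Finset.mem_Ico.mp hn').1
  have hn0 : n ≠ 0 := by omega
  have hn1r : (1 : ℝ) ≤ n := by exact_mod_cast hn1
  have hnhalf : (n : ℝ) ≤ bigP D ^ (0.5 : ℝ) := by linarith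
  set A := (‖χ (n : ZMod D)‖ : ℂ) * lamZero c' D j n / (n : ℂ)
  set M0 := deriv χ.LFunction 1 * (((n : ℝ) / P1pp D : ℝ) : ℂ) ^ (-beta6 D) /
        (Real.log (Skeleton.P1 D) : ℂ) *
      (-1 + (beta6 D - betaJ c' D j) * (Real.log ((n : ℝ) / P1pp D) : ℂ))
  set L1 := deriv χ.LFunction 1
  set G := iota3 * (Real.log (Skeleton.P3 D) : ℂ)⁻¹ * frakgW c' D j 6 (Skeleton.P3 D / n) +
            iota4 * (Real.log (Skeleton.P2 D) : ℂ)⁻¹ * frakgW c' D j 7 (Skeleton.P2 D / n)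
  set Gp := (iota3 / 0.498 * frakgW c' D j 6 (bigP D ^ (0.498 : ℝ) / n) +
              iota4 / 0.5 * frakgW c' D j 7 (bigP D ^ (0.5 : ℝ) / n)) / (Real.log (bigP D) : ℂ)
  have e : A * ((n : ℂ) / (Nat.totient n : ℂ)) * (M0 * L1 * G) -
      A * ((n : ℂ) / (Nat.totient n : ℂ)) * (M0 * L1 * Gp) =
      A * ((n : ℂ) / (Nat.totient n : ℂ)) * (M0 * L1 * (G - Gp)) := by ring
  rw [e]
  have hnφ : ‖((n : ℂ) / (Nat.totient n : ℂ))‖ = (n : ℝ) / Nat.totient n := by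
    rw [norm_div, Complex.norm_natCast, Complex.norm_natCast]
  have hM0 := norm_M0_le c' χ hℓ hp hc5 j hlo (lt_of_lt_of_le hhi hP3P2)
  have hG := norm_G_sub_Gpr_le c' hℓ hc5 j hn1r hnhalf
  have hr1 := one_le_self_div_totient hn0
  have hr3 : (n : ℝ) / Nat.totient n ≤ ((n : ℝ) / Nat.totient n) ^ 3 := by
    calc (n : ℝ) / Nat.totient n = ((n : ℝ) / Nat.totient n) ^ 1 := (pow_one _).symm
      _ ≤ ((n : ℝ) / Nat.totient n) ^ 3 := pow_le_pow_right₀ hr1 (by norm_num)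
  rw [norm_mul, norm_mul, norm_mul, norm_mul, hnφ]
  have h0 : 0 ≤ 28000 * Real.exp (9 / 2) * (ell D ^ 7)⁻¹ := by positivity
  calc ‖A‖ * ((n : ℝ) / Nat.totient n) * (‖M0‖ * ‖L1‖ * ‖G - Gp‖)
      ≤ ‖A‖ * ((n : ℝ) / Nat.totient n) ^ 3 * (28000 * Real.exp (9 / 2) * (ell D ^ 7)⁻¹ * ‖L1‖ *
          (100000 * ell D ^ (1.1 : ℝ) * (ell D ^ 18)⁻¹)) := by
        gcongr

/-- **Profile swap on `P₃ ≤ n < P₂`** (the `ι₄`-part alone, `Ranges1422.norm_G7_sub_le`).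
[cite: Zhang2022LandauSiegel, §12 p. 73; §10 p. 60] -/
theorem seven_Gswap_le (hℓ4 : 4 ≤ ell D) (hp : χ.IsPrimitive) (hc5 : 5 * |c'| * alpha D * ell D ≤ 1)
    (j : ℕ) :
    ‖(∑ n ∈ ((Finset.Ico 1 (Nsupp D)).filter
          (fun n : ℕ => P1pp D < n ∧ (n : ℝ) < Skeleton.P2 D)).filter
            (fun n : ℕ => ¬ ((n : ℝ) < Skeleton.P3 D)),
      (‖χ (n : ZMod D)‖ : ℂ) * lamZero c' D j n / (n : ℂ) * ((n : ℂ) / (Nat.totient n : ℂ)) *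
        (deriv χ.LFunction 1 * (((n : ℝ) / P1pp D : ℝ) : ℂ) ^ (-beta6 D) /
              (Real.log (Skeleton.P1 D) : ℂ) *
            (-1 + (beta6 D - betaJ c' D j) * (Real.log ((n : ℝ) / P1pp D) : ℂ)) *
          deriv χ.LFunction 1 *
          (iota4 * (Real.log (Skeleton.P2 D) : ℂ)⁻¹ * frakgW c' D j 7 (Skeleton.P2 D / n)))) -
      ∑ n ∈ ((Finset.Ico 1 (Nsupp D)).filter
          (fun n : ℕ => P1pp D < n ∧ (n : ℝ) < Skeleton.P2 D)).filter
            (fun n : ℕ => ¬ ((n : ℝ) < Skeleton.P3 D)),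
      (‖χ (n : ZMod D)‖ : ℂ) * lamZero c' D j n / (n : ℂ) * ((n : ℂ) / (Nat.totient n : ℂ)) *
        (deriv χ.LFunction 1 * (((n : ℝ) / P1pp D : ℝ) : ℂ) ^ (-beta6 D) /
              (Real.log (Skeleton.P1 D) : ℂ) *
            (-1 + (beta6 D - betaJ c' D j) * (Real.log ((n : ℝ) / P1pp D) : ℂ)) *
          deriv χ.LFunction 1 *
          (iota4 / 0.5 * frakgW c' D j 7 (bigP D ^ (0.5 : ℝ) / n) / (Real.log (bigP D) : ℂ)))‖ ≤
      (∑ n ∈ ((Finset.Ico 1 (Nsupp D)).filter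
          (fun n : ℕ => P1pp D < n ∧ (n : ℝ) < Skeleton.P2 D)).filter
            (fun n : ℕ => ¬ ((n : ℝ) < Skeleton.P3 D)),
          ‖(‖χ (n : ZMod D)‖ : ℂ) * lamZero c' D j n / (n : ℂ)‖ * ((n : ℝ) / Nat.totient n) ^ 3) *
        (28000 * Real.exp (9 / 2) * (ell D ^ 7)⁻¹ * ‖deriv χ.LFunction 1‖ *
          (100000 * ell D ^ (1.1 : ℝ) * (ell D ^ 18)⁻¹)) := by
  have hℓ : 3 ≤ ell D := by linarith
  have hℓ0 : 0 < ell D := by linarith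
  obtain ⟨-, -, hP2le, hP3def, -⟩ := window_facts (D := D) hℓ
  rw [← Finset.sum_sub_distrib, Finset.sum_mul]
  refine (norm_sum_le _ _).trans (Finset.sum_le_sum fun n hn => ?_)
  obtain ⟨hn'', hP3n⟩ := Finset.mem_filter.mp hn
  obtain ⟨hn', hlo, hhi⟩ := Finset.mem_filter.mp hn''
  have hn1 : 1 ≤ n := (Finset.mem_Ico.mp hn').1
  have hn0 : n ≠ 0 := by omega
  have hn1r : (1 : ℝ) ≤ n := by exact_mod_cast hn1
  have hnhalf : (n : ℝ) ≤ bigP D ^ (0.5 : ℝ) := by linarith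
  set A := (‖χ (n : ZMod D)‖ : ℂ) * lamZero c' D j n / (n : ℂ)
  set M0 := deriv χ.LFunction 1 * (((n : ℝ) / P1pp D : ℝ) : ℂ) ^ (-beta6 D) /
        (Real.log (Skeleton.P1 D) : ℂ) *
      (-1 + (beta6 D - betaJ c' D j) * (Real.log ((n : ℝ) / P1pp D) : ℂ))
  set L1 := deriv χ.LFunction 1
  set G := iota4 * (Real.log (Skeleton.P2 D) : ℂ)⁻¹ * frakgW c' D j 7 (Skeleton.P2 D / n)
  set Gp := iota4 / 0.5 * frakgW c' D j 7 (bigP D ^ (0.5 : ℝ) / n) / (Real.log (bigP D) : ℂ)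
  have e : A * ((n : ℂ) / (Nat.totient n : ℂ)) * (M0 * L1 * G) -
      A * ((n : ℂ) / (Nat.totient n : ℂ)) * (M0 * L1 * Gp) =
      A * ((n : ℂ) / (Nat.totient n : ℂ)) * (M0 * L1 * (G - Gp)) := by ring
  rw [e]
  have hnφ : ‖((n : ℂ) / (Nat.totient n : ℂ))‖ = (n : ℝ) / Nat.totient n := by
    rw [norm_div, Complex.norm_natCast, Complex.norm_natCast]
  have hM0 := norm_M0_le c' χ hℓ hp hc5 j hlo hhi
  have hG := norm_G7_sub_le c' hℓ hc5 j hn1r hnhalf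
  have hr1 := one_le_self_div_totient hn0
  have hr3 : (n : ℝ) / Nat.totient n ≤ ((n : ℝ) / Nat.totient n) ^ 3 := by
    calc (n : ℝ) / Nat.totient n = ((n : ℝ) / Nat.totient n) ^ 1 := (pow_one _).symm
      _ ≤ ((n : ℝ) / Nat.totient n) ^ 3 := pow_le_pow_right₀ hr1 (by norm_num)
  rw [norm_mul, norm_mul, norm_mul, norm_mul, hnφ]
  have h0 : 0 ≤ 28000 * Real.exp (9 / 2) * (ell D ^ 7)⁻¹ := by positivity
  calc ‖A‖ * ((n : ℝ) / Nat.totient n) * (‖M0‖ * ‖L1‖ * ‖G - Gp‖)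
      ≤ ‖A‖ * ((n : ℝ) / Nat.totient n) ^ 3 * (28000 * Real.exp (9 / 2) * (ell D ^ 7)⁻¹ * ‖L1‖ *
          (100000 * ell D ^ (1.1 : ℝ) * (ell D ^ 18)⁻¹)) := by
        gcongr

end GSwap

/-! ## Part W. Weight sums over the two sub-ranges and their windows -/

section Weights

variable (c' : ℝ) {D : ℕ} (χ : DirichletCharacter ℂ D)

omit χ in
/-- `𝓛^{1.1} ≤ 𝓛²` (`𝓛 ≥ 1`). [folklore] -/
private theorem ell_rpow_le_sq' (h1 : 1 ≤ ell D) : ell D ^ (1.1 : ℝ) ≤ ell D ^ 2 := by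
  have h : ell D ^ (1.1 : ℝ) ≤ ell D ^ (2 : ℝ) := Real.rpow_le_rpow_of_exponent_le h1 (by norm_num)
  simpa using h

omit χ in
/-- `𝓛 ≤ 𝓛^{1.1}` (`𝓛 ≥ 1`). [folklore] -/
private theorem ell_le_rpow' (h1 : 1 ≤ ell D) : ell D ≤ ell D ^ (1.1 : ℝ) := by
  have h : ell D ^ (1 : ℝ) ≤ ell D ^ (1.1 : ℝ) := Real.rpow_le_rpow_of_exponent_le h1 (by norm_num)
  simpa using h

/-- **Weights of the whole sub-range `P″₁ < n < P₃`**: `≤ e^{256}(3 + 0.002𝓛⁹)` (`P″₁ ≥ P^{0.496}`).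
[cite: Zhang2022LandauSiegel, §12 p. 73; §10 pp. 59–60] -/
theorem six_weights_all_le (hℓ : 3 ≤ ell D) (j : ℕ) :
    ∑ n ∈ (Finset.Ico 1 (Nsupp D)).filter
        (fun n : ℕ => P1pp D < n ∧ (n : ℝ) < Skeleton.P3 D),
      ‖(‖χ (n : ZMod D)‖ : ℂ) * lamZero c' D j n / (n : ℂ)‖ * ((n : ℝ) / Nat.totient n) ^ 3 ≤
      Real.exp 256 * (3 + 0.002 * ell D ^ 9) := by
  obtain ⟨h2, hab, -, -, -, -, -⟩ := range_facts (D := D) hℓ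
  obtain ⟨h496, -, -, hP3def, -⟩ := window_facts (D := D) hℓ
  have h := sum_weights_le c' χ j h2 hab (S' := (Finset.Ico 1 (Nsupp D)).filter
        (fun n : ℕ => P1pp D < n ∧ (n : ℝ) < Skeleton.P3 D))
    (fun n hn => by
      obtain ⟨-, hlo, hhi⟩ := Finset.mem_filter.mp hn
      exact ⟨by linarith, by rw [hP3def] at hhi; exact hhi.le⟩)
  rw [Skeleton.log_bigP_rpow, Skeleton.log_bigP_rpow] at h
  refine h.trans (le_of_eq ?_)
  ring

/-- **Window weights of the sub-range `P″₁ < n < P₃`** (`n ≥ P₃/T`): `≤ e^{256}(3 + 𝓛^{1.1})`.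
[cite: Zhang2022LandauSiegel, §12 p. 73; §10 pp. 59–60] -/
theorem six_weights_window_le (hℓ : 3 ≤ ell D) (j : ℕ) :
    ∑ n ∈ ((Finset.Ico 1 (Nsupp D)).filter
        (fun n : ℕ => P1pp D < n ∧ (n : ℝ) < Skeleton.P3 D)).filter
          (fun n : ℕ => ¬ ((n : ℝ) < Skeleton.P3 D / bigT D)),
      ‖(‖χ (n : ZMod D)‖ : ℂ) * lamZero c' D j n / (n : ℂ)‖ * ((n : ℝ) / Nat.totient n) ^ 3 ≤
      Real.exp 256 * (3 + ell D ^ (1.1 : ℝ)) := by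
  have hℓ0 : 0 < ell D := by linarith
  have hℓ1 : 1 ≤ ell D := by linarith
  obtain ⟨-, -, -, hP3def, -⟩ := window_facts (D := D) hℓ
  have hT := bigT_pos D
  have hT1 := Sec12D.one_le_bigT D
  have hu2 : 2 ≤ bigP D ^ (0.498 : ℝ) / bigT D := by
    refine two_le_rpow_div hT ?_
    rw [Skeleton.log_bigT]
    have h11 := ell_rpow_le_sq' (D := D) hℓ1
    have h7 : (3 : ℝ) ^ 7 ≤ ell D ^ 7 := pow_le_pow_left₀ (by norm_num) hℓ 7
    nlinarith [pow_nonneg hℓ0.le 2]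
  have hv : bigP D ^ (0.498 : ℝ) / bigT D ≤ bigP D ^ (0.498 : ℝ) :=
    div_le_self (bigP_rpow_pos D _).le hT1
  have h := sum_weights_le c' χ j hu2 hv
    (S' := ((Finset.Ico 1 (Nsupp D)).filter
        (fun n : ℕ => P1pp D < n ∧ (n : ℝ) < Skeleton.P3 D)).filter
          (fun n : ℕ => ¬ ((n : ℝ) < Skeleton.P3 D / bigT D)))
    (fun n hn => by
      obtain ⟨hn', hle⟩ := Finset.mem_filter.mp hn
      obtain ⟨-, -, hhi⟩ := Finset.mem_filter.mp hn'
      rw [not_lt, hP3def] at hle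
      rw [hP3def] at hhi
      exact ⟨hle, hhi.le⟩)
  refine h.trans (le_of_eq ?_)
  rw [Real.log_div (bigP_rpow_pos D _).ne' hT.ne', Skeleton.log_bigT]
  ring

/-- **Weights of the whole sub-range `P₃ ≤ n < P₂`**: `≤ e^{256}(3 + 0.002𝓛⁹)` (`P₂ ≤ P^{0.5}`).
[cite: Zhang2022LandauSiegel, §12 p. 73; §10 p. 60] -/
theorem seven_weights_all_le (hℓ : 3 ≤ ell D) (j : ℕ) :
    ∑ n ∈ ((Finset.Ico 1 (Nsupp D)).filter
          (fun n : ℕ => P1pp D < n ∧ (n : ℝ) < Skeleton.P2 D)).filter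
            (fun n : ℕ => ¬ ((n : ℝ) < Skeleton.P3 D)),
      ‖(‖χ (n : ZMod D)‖ : ℂ) * lamZero c' D j n / (n : ℂ)‖ * ((n : ℝ) / Nat.totient n) ^ 3 ≤
      Real.exp 256 * (3 + 0.002 * ell D ^ 9) := by
  obtain ⟨h2, hab, hb5, -, -, -, -⟩ := range_facts (D := D) hℓ
  obtain ⟨-, -, hP2le, hP3def, -⟩ := window_facts (D := D) hℓ
  have h := sum_weights_le c' χ j (h2.trans hab) hb5
    (S' := ((Finset.Ico 1 (Nsupp D)).filter
          (fun n : ℕ => P1pp D < n ∧ (n : ℝ) < Skeleton.P2 D)).filter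
            (fun n : ℕ => ¬ ((n : ℝ) < Skeleton.P3 D)))
    (fun n hn => by
      obtain ⟨hn', hle⟩ := Finset.mem_filter.mp hn
      obtain ⟨-, -, hhi⟩ := Finset.mem_filter.mp hn'
      rw [not_lt, hP3def] at hle
      exact ⟨hle, by linarith⟩)
  rw [Skeleton.log_bigP_rpow, Skeleton.log_bigP_rpow] at h
  refine h.trans (le_of_eq ?_)
  ring

/-- **Window weights of the sub-range `P₃ ≤ n < P₂`** (`n ≥ P^{0.5}T^{−11}`): `≤ e^{256}(3 + 11𝓛^{1.1})`.
[cite: Zhang2022LandauSiegel, §12 p. 73; §10 p. 60] -/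
theorem seven_weights_window_le (hℓ : 3 ≤ ell D) (j : ℕ) :
    ∑ n ∈ (((Finset.Ico 1 (Nsupp D)).filter
          (fun n : ℕ => P1pp D < n ∧ (n : ℝ) < Skeleton.P2 D)).filter
            (fun n : ℕ => ¬ ((n : ℝ) < Skeleton.P3 D))).filter
            (fun n : ℕ => ¬ ((n : ℝ) < bigP D ^ (0.5 : ℝ) / bigT D ^ 11)),
      ‖(‖χ (n : ZMod D)‖ : ℂ) * lamZero c' D j n / (n : ℂ)‖ * ((n : ℝ) / Nat.totient n) ^ 3 ≤
      Real.exp 256 * (3 + 11 * ell D ^ (1.1 : ℝ)) := by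
  have hℓ0 : 0 < ell D := by linarith
  have hℓ1 : 1 ≤ ell D := by linarith
  obtain ⟨-, -, hP2le, hP3def, -⟩ := window_facts (D := D) hℓ
  have hT := bigT_pos D
  have hT1 := Sec12D.one_le_bigT D
  have hT11 : 0 < bigT D ^ 11 := pow_pos hT 11
  have hT11' : 1 ≤ bigT D ^ 11 := one_le_pow₀ hT1
  have hu2 : 2 ≤ bigP D ^ (0.5 : ℝ) / bigT D ^ 11 := by
    refine two_le_rpow_div hT11 ?_
    rw [Real.log_pow, Skeleton.log_bigT]
    have h11 := ell_rpow_le_sq' (D := D) hℓ1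
    have h7 : (3 : ℝ) ^ 7 ≤ ell D ^ 7 := pow_le_pow_left₀ (by norm_num) hℓ 7
    push_cast
    nlinarith [pow_nonneg hℓ0.le 2]
  have hv : bigP D ^ (0.5 : ℝ) / bigT D ^ 11 ≤ bigP D ^ (0.5 : ℝ) :=
    div_le_self (bigP_rpow_pos D _).le hT11'
  have h := sum_weights_le c' χ j hu2 hv
    (S' := (((Finset.Ico 1 (Nsupp D)).filter
          (fun n : ℕ => P1pp D < n ∧ (n : ℝ) < Skeleton.P2 D)).filter
            (fun n : ℕ => ¬ ((n : ℝ) < Skeleton.P3 D))).filter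
            (fun n : ℕ => ¬ ((n : ℝ) < bigP D ^ (0.5 : ℝ) / bigT D ^ 11)))
    (fun n hn => by
      obtain ⟨hn', hle⟩ := Finset.mem_filter.mp hn
      obtain ⟨hn'', -⟩ := Finset.mem_filter.mp hn'
      obtain ⟨-, -, hhi⟩ := Finset.mem_filter.mp hn''
      rw [not_lt] at hle
      exact ⟨hle, by linarith⟩)
  refine h.trans (le_of_eq ?_)
  rw [Real.log_div (bigP_rpow_pos D _).ne' hT11.ne', Real.log_pow, Skeleton.log_bigT]
  push_cast
  ring

end Weights

/-! ## Part D. The collapsed main terms ARE the printed-shape window sums with the exact weight -/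

section MainTerms

variable (c' : ℝ) {D : ℕ} [NeZero D] (χ : DirichletCharacter ℂ D)

omit [NeZero D] χ in
/-- `log P₁ = 0.504 log P` in `ℂ`. [cite: Zhang2022LandauSiegel, §2 (2.21)] -/
theorem logP1_cast (D : ℕ) :
    (Real.log (Skeleton.P1 D) : ℂ) = (0.504 : ℂ) * (Real.log (bigP D) : ℂ) := by
  rw [Sec12D.log_P1_eq_mul]; push_cast; ring

/-- **Main term on `P″₁ < n < P₃`**: the collapsed sum is
`(L′²ι₃/((0.504)(0.498)log²P))Σ|χ|λ₀ⱼφ⁻¹𝓖_{j6}(P^{0.498}/n)𝓦*ex_j(n) + (L′²ι₄/((0.504)(0.5)log²P))Σ|χ|λ₀ⱼφ⁻¹𝓖_{j7}(P^{0.5}/n)𝓦*ex_j(n)`.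
[cite: Zhang2022LandauSiegel, §12 p. 73 (tex L3694)] -/
theorem six_mainterm_eq (hℓ : 3 ≤ ell D) (j : ℕ) :
    ∑ n ∈ (Finset.Ico 1 (Nsupp D)).filter
        (fun n : ℕ => P1pp D < n ∧ (n : ℝ) < Skeleton.P3 D),
      (‖χ (n : ZMod D)‖ : ℂ) * lamZero c' D j n / (n : ℂ) * ((n : ℂ) / (Nat.totient n : ℂ)) *
        (deriv χ.LFunction 1 * (((n : ℝ) / P1pp D : ℝ) : ℂ) ^ (-beta6 D) /
              (Real.log (Skeleton.P1 D) : ℂ) *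
            (-1 + (beta6 D - betaJ c' D j) * (Real.log ((n : ℝ) / P1pp D) : ℂ)) *
          deriv χ.LFunction 1 *
          ((iota3 / 0.498 * frakgW c' D j 6 (bigP D ^ (0.498 : ℝ) / n) +
              iota4 / 0.5 * frakgW c' D j 7 (bigP D ^ (0.5 : ℝ) / n)) / (Real.log (bigP D) : ℂ))) =
      deriv χ.LFunction 1 ^ 2 * iota3 / (0.504 * 0.498 * (Real.log (bigP D) : ℂ) ^ 2) *
          ∑ n ∈ (Finset.Ico 1 (Nsupp D)).filter
            (fun n : ℕ => P1pp D < n ∧ (n : ℝ) < Skeleton.P3 D),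
            (‖χ (n : ZMod D)‖ : ℂ) * lamZero c' D j n / (Nat.totient n : ℂ) *
              (frakgW c' D j 6 (bigP D ^ (0.498 : ℝ) / n) *
                ((((n : ℝ) / P1pp D : ℝ) : ℂ) ^ (-beta6 D) *
                  (-1 + (beta6 D - betaJ c' D j) * (Real.log ((n : ℝ) / P1pp D) : ℂ)))) +
        deriv χ.LFunction 1 ^ 2 * iota4 / (0.504 * 0.5 * (Real.log (bigP D) : ℂ) ^ 2) *
          ∑ n ∈ (Finset.Ico 1 (Nsupp D)).filter
            (fun n : ℕ => P1pp D < n ∧ (n : ℝ) < Skeleton.P3 D),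
            (‖χ (n : ZMod D)‖ : ℂ) * lamZero c' D j n / (Nat.totient n : ℂ) *
              (frakgW c' D j 7 (bigP D ^ (0.5 : ℝ) / n) *
                ((((n : ℝ) / P1pp D : ℝ) : ℂ) ^ (-beta6 D) *
                  (-1 + (beta6 D - betaJ c' D j) * (Real.log ((n : ℝ) / P1pp D) : ℂ)))) := by
  have hℓ0 : 0 < ell D := by linarith
  have hlogP : (Real.log (bigP D) : ℂ) ≠ 0 := by
    rw [Typed.Sec12A.log_bigP]; exact_mod_cast (by positivity : ell D ^ 9 ≠ 0)
  rw [Finset.mul_sum, Finset.mul_sum, ← Finset.sum_add_distrib]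
  refine Finset.sum_congr rfl fun n hn => ?_
  have hn1 : 1 ≤ n := (Finset.mem_Ico.mp (Finset.mem_filter.mp hn).1).1
  have hn0 : (n : ℂ) ≠ 0 := by exact_mod_cast (by omega : n ≠ 0)
  have hφ : (Nat.totient n : ℂ) ≠ 0 := by
    exact_mod_cast (Nat.totient_pos.mpr (by omega)).ne'
  rw [logP1_cast]
  field_simp

/-- **Main term on `P₃ ≤ n < P₂`**: the collapsed sum is `(L′²ι₄/((0.504)(0.5)log²P))Σ|χ|λ₀ⱼφ⁻¹𝓖_{j7}(P^{0.5}/n)𝓦*ex_j(n)`.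
[cite: Zhang2022LandauSiegel, §12 p. 73 (tex L3694)] -/
theorem seven_mainterm_eq (hℓ : 3 ≤ ell D) (j : ℕ) :
    ∑ n ∈ ((Finset.Ico 1 (Nsupp D)).filter
          (fun n : ℕ => P1pp D < n ∧ (n : ℝ) < Skeleton.P2 D)).filter
            (fun n : ℕ => ¬ ((n : ℝ) < Skeleton.P3 D)),
      (‖χ (n : ZMod D)‖ : ℂ) * lamZero c' D j n / (n : ℂ) * ((n : ℂ) / (Nat.totient n : ℂ)) *
        (deriv χ.LFunction 1 * (((n : ℝ) / P1pp D : ℝ) : ℂ) ^ (-beta6 D) /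
              (Real.log (Skeleton.P1 D) : ℂ) *
            (-1 + (beta6 D - betaJ c' D j) * (Real.log ((n : ℝ) / P1pp D) : ℂ)) *
          deriv χ.LFunction 1 *
          (iota4 / 0.5 * frakgW c' D j 7 (bigP D ^ (0.5 : ℝ) / n) / (Real.log (bigP D) : ℂ))) =
      deriv χ.LFunction 1 ^ 2 * iota4 / (0.504 * 0.5 * (Real.log (bigP D) : ℂ) ^ 2) *
        ∑ n ∈ ((Finset.Ico 1 (Nsupp D)).filter
            (fun n : ℕ => P1pp D < n ∧ (n : ℝ) < Skeleton.P2 D)).filter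
              (fun n : ℕ => ¬ ((n : ℝ) < Skeleton.P3 D)),
          (‖χ (n : ZMod D)‖ : ℂ) * lamZero c' D j n / (Nat.totient n : ℂ) *
            (frakgW c' D j 7 (bigP D ^ (0.5 : ℝ) / n) *
              ((((n : ℝ) / P1pp D : ℝ) : ℂ) ^ (-beta6 D) *
                (-1 + (beta6 D - betaJ c' D j) * (Real.log ((n : ℝ) / P1pp D) : ℂ)))) := by
  have hℓ0 : 0 < ell D := by linarith
  have hlogP : (Real.log (bigP D) : ℂ) ≠ 0 := by
    rw [Typed.Sec12A.log_bigP]; exact_mod_cast (by positivity : ell D ^ 9 ≠ 0)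
  rw [Finset.mul_sum]
  refine Finset.sum_congr rfl fun n hn => ?_
  have hn1 : 1 ≤ n := (Finset.mem_Ico.mp (Finset.mem_filter.mp (Finset.mem_filter.mp hn).1).1).1
  have hn0 : (n : ℂ) ≠ 0 := by exact_mod_cast (by omega : n ≠ 0)
  have hφ : (Nat.totient n : ℂ) ≠ 0 := by
    exact_mod_cast (Nat.totient_pos.mpr (by omega)).ne'
  rw [logP1_cast]
  field_simp

end MainTerms

/-! ## Part E. The two sub-ranges at a fixed modulus, and the edge -/

section AtModulus

variable (c' : ℝ) {D : ℕ} [NeZero D] (χ : DirichletCharacter ℂ D)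

/-- Monotonicity of the exact Lemma 12.1 body in its constant.
[cite: Zhang2022LandauSiegel, §12 proof of Lemma 12.1 p. 68] -/
theorem body020_mono {c C C' : ℝ} (hCC' : C ≤ C')
    (h020 : ∀ j ∈ ({1, 2, 3} : Finset ℕ), ∀ d : ℕ, 1 ≤ d → P1pp D < d → (d : ℝ) < Skeleton.P2 D →
      ‖Typed.Sec12B.sum121 c' χ j d - Typed.Sec12B.line020 c' χ j d‖ ≤ C * bigT D ^ (-c) ∧
      ‖Typed.Sec12B.line020 c' χ j d -
          deriv χ.LFunction 1 * (((d : ℝ) / P1pp D : ℝ) : ℂ) ^ (-beta6 D) /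
              (Real.log (Skeleton.P1 D) : ℂ) *
            (-1 + (beta6 D - betaJ c' D j) * (Real.log ((d : ℝ) / P1pp D) : ℂ))‖ ≤
        C * (ell D ^ 15)⁻¹) :
    ∀ j ∈ ({1, 2, 3} : Finset ℕ), ∀ d : ℕ, 1 ≤ d → P1pp D < d → (d : ℝ) < Skeleton.P2 D →
      ‖Typed.Sec12B.sum121 c' χ j d - Typed.Sec12B.line020 c' χ j d‖ ≤ C' * bigT D ^ (-c) ∧
      ‖Typed.Sec12B.line020 c' χ j d -
          deriv χ.LFunction 1 * (((d : ℝ) / P1pp D : ℝ) : ℂ) ^ (-beta6 D) /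
              (Real.log (Skeleton.P1 D) : ℂ) *
            (-1 + (beta6 D - betaJ c' D j) * (Real.log ((d : ℝ) / P1pp D) : ℂ))‖ ≤
        C' * (ell D ^ 15)⁻¹ := by
  have hT : 0 ≤ bigT D ^ (-c) := (Real.rpow_pos_of_pos (bigT_pos D) _).le
  have hℓ : 0 ≤ ell D := by rw [ell]; exact Real.log_natCast_nonneg D
  have h15 : 0 ≤ (ell D ^ 15)⁻¹ := inv_nonneg.mpr (pow_nonneg hℓ _)
  intro j hj d hd h1 h2
  obtain ⟨a, b⟩ := h020 j hj d hd h1 h2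
  exact ⟨a.trans (mul_le_mul_of_nonneg_right hCC' hT), b.trans (mul_le_mul_of_nonneg_right hCC' h15)⟩

/-- **The sub-range `P″₁ < n < P₃` at a fixed modulus**: under the bodies of the exact Lemma 12.1
(`C₁`, exponent `c` with `T^{−c} ≤ 𝓛⁻¹⁵`), of the relative Lemma 8.4 (`C₂`) and of the `ξ₀`-tail mean
(`C₃`), for `𝓛 ≥ 4` and `5|c′|α𝓛 ≤ 1`: the re-indexed range sum is its printed-shape main term up to
`K(C₁⁺,C₂⁺,C₃⁺)·𝓛^{5.5}·𝓛⁻¹⁵`. [cite: Zhang2022LandauSiegel, §12 p. 73 (tex L3694)] -/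
theorem six_at (hℓ4 : 4 ≤ ell D) (hq : χ.IsQuadratic) (hp : χ.IsPrimitive)
    (hc5 : 5 * |c'| * alpha D * ell D ≤ 1) {c C₁ C₂ C₃ : ℝ}
    (hTc : bigT D ^ (-c) ≤ (ell D ^ 15)⁻¹)
    (h020 : ∀ j ∈ ({1, 2, 3} : Finset ℕ), ∀ d : ℕ, 1 ≤ d → P1pp D < d → (d : ℝ) < Skeleton.P2 D →
      ‖Typed.Sec12B.sum121 c' χ j d - Typed.Sec12B.line020 c' χ j d‖ ≤ C₁ * bigT D ^ (-c) ∧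
      ‖Typed.Sec12B.line020 c' χ j d -
          deriv χ.LFunction 1 * (((d : ℝ) / P1pp D : ℝ) : ℂ) ^ (-beta6 D) /
              (Real.log (Skeleton.P1 D) : ℂ) *
            (-1 + (beta6 D - betaJ c' D j) * (Real.log ((d : ℝ) / P1pp D) : ℂ))‖ ≤
        C₁ * (ell D ^ 15)⁻¹)
    (h84 : ∀ j ∈ ({1, 2, 3} : Finset ℕ), ∀ μ ∈ ({6, 7} : Finset ℕ), ∀ d r : ℕ, 1 ≤ d → 1 ≤ r →
      ((d * r : ℕ) : ℝ) < bigP D / bigT D ^ 2 → ∀ y : ℝ, bigT D < y → y < bigP D →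
        ‖(∑ n ∈ Finset.Ico 1 ⌈y⌉₊, χ (n : ZMod D) * xiZero c' D j n d r / (n : ℂ) *
              ((y / n : ℝ) : ℂ) ^ (-betaMu D μ) * (Real.log (y / n) : ℂ)) -
            deriv χ.LFunction 1 * PiW χ d r * frakgW c' D j μ y‖ ≤
          C₂ * (ell D ^ 6)⁻¹ * (∏ q ∈ (d * r).primeFactors, (1 - (q : ℝ)⁻¹)⁻¹) ^ 2)
    (h3 : ∀ j ∈ ({1, 2, 3} : Finset ℕ), ∀ d r : ℕ, 1 ≤ d → 1 ≤ r →
      ((d * r : ℕ) : ℝ) < Skeleton.P1 D → ∀ x : ℝ, 1 ≤ x → x ≤ bigT D →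
        ∑ n ∈ Finset.Ico 1 ⌈x⌉₊, ‖xiZero c' D j n d r‖ / n ≤ C₃ * ell D * (1 + Real.log x) ^ 3)
    {j : ℕ} (hj : j ∈ ({1, 2, 3} : Finset ℕ)) :
    ‖(∑ n ∈ (Finset.Ico 1 (Nsupp D)).filter
          (fun n : ℕ => P1pp D < n ∧ (n : ℝ) < Skeleton.P3 D),
        ∑ r ∈ n.divisors,
          (if Squarefree r then
            (‖χ (n : ZMod D)‖ : ℂ) * lamZero c' D j n / (n : ℂ) / (Nat.totient r : ℂ) *
              Typed.Sec12B.sum121 c' χ j n * nSum22 c' χ j (n / r) r else 0)) -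
      (deriv χ.LFunction 1 ^ 2 * iota3 / (0.504 * 0.498 * (Real.log (bigP D) : ℂ) ^ 2) *
          ∑ n ∈ (Finset.Ico 1 (Nsupp D)).filter
            (fun n : ℕ => P1pp D < n ∧ (n : ℝ) < Skeleton.P3 D),
            (‖χ (n : ZMod D)‖ : ℂ) * lamZero c' D j n / (Nat.totient n : ℂ) *
              (frakgW c' D j 6 (bigP D ^ (0.498 : ℝ) / n) *
                ((((n : ℝ) / P1pp D : ℝ) : ℂ) ^ (-beta6 D) *
                  (-1 + (beta6 D - betaJ c' D j) * (Real.log ((n : ℝ) / P1pp D) : ℂ)))) +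
        deriv χ.LFunction 1 ^ 2 * iota4 / (0.504 * 0.5 * (Real.log (bigP D) : ℂ) ^ 2) *
          ∑ n ∈ (Finset.Ico 1 (Nsupp D)).filter
            (fun n : ℕ => P1pp D < n ∧ (n : ℝ) < Skeleton.P3 D),
            (‖χ (n : ZMod D)‖ : ℂ) * lamZero c' D j n / (Nat.totient n : ℂ) *
              (frakgW c' D j 7 (bigP D ^ (0.5 : ℝ) / n) *
                ((((n : ℝ) / P1pp D : ℝ) : ℂ) ^ (-beta6 D) *
                  (-1 + (beta6 D - betaJ c' D j) * (Real.log ((n : ℝ) / P1pp D) : ℂ)))))‖ ≤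
      Real.exp 256 *
          ((28000 * Real.exp (9 / 2) + 2 * max C₁ 0 + 2000 * Real.exp (9 / 2) * (4 * π) * 520) * 9 *
              max C₂ 0 +
            (2 * max C₁ 0 + 2000 * Real.exp (9 / 2) * (4 * π) * 520) * (4 * Real.exp (9 / 2)) * 146 * 9 +
            537 * (2 * max C₁ 0 + 28000 * Real.exp (9 / 2)) * 9 *
              (584 * Real.exp (9 / 2) + max C₂ 0 + 8 * max C₃ 0) +
            537 * (28000 * Real.exp (9 / 2)) * (4 * Real.exp (9 / 2)) * 146 * 9 +
            28000 * Real.exp (9 / 2) * (4 * Real.exp (9 / 2)) * 100000) *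
        (ell D ^ (1.1 : ℝ)) ^ 5 * (ell D ^ 15)⁻¹ := by
  classical
  have hℓ : 3 ≤ ell D := by linarith
  have hℓ1 : 1 ≤ ell D := by linarith
  have hℓ0 : 0 < ell D := by linarith
  have h020' := body020_mono c' χ (le_max_left C₁ 0) h020
  have h84' := body84_mono c' χ (le_max_left C₂ 0) h84
  have h3' := body3_mono c' (le_max_left C₃ 0) h3
  have hA := six_assembly_le c' χ hℓ4 hq hp hc5 (le_max_right C₁ 0) (le_max_right C₂ 0)
    (le_max_right C₃ 0) hTc h020' h84' h3' hj
  have hB := six_Gswap_le c' χ hℓ4 hp hc5 j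
  have hC := six_mainterm_eq c' χ hℓ j
  rw [hC] at hB
  rw [Skeleton.log_bigT] at hA
  refine (norm_sub_le_norm_sub_add_norm_sub _ _ _).trans ((add_le_add hA hB).trans ?_)
  -- weights
  have hτ := ell_le_rpow' (D := D) hℓ1
  have h9 : 3 + 0.002 * ell D ^ 9 ≤ ell D ^ 9 := by
    have : (3 : ℝ) ^ 9 ≤ ell D ^ 9 := pow_le_pow_left₀ (by norm_num) hℓ 9
    nlinarith
  have hWa := (six_weights_all_le c' χ hℓ j).trans
    (mul_le_mul_of_nonneg_left h9 (Real.exp_pos _).le)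
  have hWw : _ ≤ 537 * Real.exp 256 * ell D ^ (1.1 : ℝ) :=
    (six_weights_window_le c' χ hℓ j).trans (by nlinarith [Real.exp_pos 256])
  have hWm : (∑ n ∈ ((Finset.Ico 1 (Nsupp D)).filter
        (fun n : ℕ => P1pp D < n ∧ (n : ℝ) < Skeleton.P3 D)).filter
          (fun n : ℕ => (n : ℝ) < Skeleton.P3 D / bigT D),
        ‖(‖χ (n : ZMod D)‖ : ℂ) * lamZero c' D j n / (n : ℂ)‖ * ((n : ℝ) / Nat.totient n) ^ 3) ≤
      Real.exp 256 * ell D ^ 9 :=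
    (Finset.sum_le_sum_of_subset_of_nonneg (Finset.filter_subset _ _)
      (fun n _ _ => by positivity)).trans hWa
  exact mid_numeric_bound (C₁ := 2 * max C₁ 0) (τ := ell D ^ (1.1 : ℝ)) (L := ‖deriv χ.LFunction 1‖)
    (R := ‖iota3‖ / Real.log (Skeleton.P3 D) + ‖iota4‖ / Real.log (Skeleton.P2 D))
    hℓ hτ hWm hWw hWa (iotaR_nonneg hℓ) (iotaR_le hℓ) (norm_nonneg _)
    (norm_deriv_L_one_le χ hℓ hp) (by positivity) (le_max_right _ _) (le_max_right _ _)

/-- **The sub-range `P₃ ≤ n < P₂` at a fixed modulus** (same bodies and thresholds as `six_at`).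
[cite: Zhang2022LandauSiegel, §12 p. 73 (tex L3694)] -/
theorem seven_at (hℓ4 : 4 ≤ ell D) (hq : χ.IsQuadratic) (hp : χ.IsPrimitive)
    (hc5 : 5 * |c'| * alpha D * ell D ≤ 1) {c C₁ C₂ C₃ : ℝ}
    (hTc : bigT D ^ (-c) ≤ (ell D ^ 15)⁻¹)
    (h020 : ∀ j ∈ ({1, 2, 3} : Finset ℕ), ∀ d : ℕ, 1 ≤ d → P1pp D < d → (d : ℝ) < Skeleton.P2 D →
      ‖Typed.Sec12B.sum121 c' χ j d - Typed.Sec12B.line020 c' χ j d‖ ≤ C₁ * bigT D ^ (-c) ∧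
      ‖Typed.Sec12B.line020 c' χ j d -
          deriv χ.LFunction 1 * (((d : ℝ) / P1pp D : ℝ) : ℂ) ^ (-beta6 D) /
              (Real.log (Skeleton.P1 D) : ℂ) *
            (-1 + (beta6 D - betaJ c' D j) * (Real.log ((d : ℝ) / P1pp D) : ℂ))‖ ≤
        C₁ * (ell D ^ 15)⁻¹)
    (h84 : ∀ j ∈ ({1, 2, 3} : Finset ℕ), ∀ μ ∈ ({6, 7} : Finset ℕ), ∀ d r : ℕ, 1 ≤ d → 1 ≤ r →
      ((d * r : ℕ) : ℝ) < bigP D / bigT D ^ 2 → ∀ y : ℝ, bigT D < y → y < bigP D →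
        ‖(∑ n ∈ Finset.Ico 1 ⌈y⌉₊, χ (n : ZMod D) * xiZero c' D j n d r / (n : ℂ) *
              ((y / n : ℝ) : ℂ) ^ (-betaMu D μ) * (Real.log (y / n) : ℂ)) -
            deriv χ.LFunction 1 * PiW χ d r * frakgW c' D j μ y‖ ≤
          C₂ * (ell D ^ 6)⁻¹ * (∏ q ∈ (d * r).primeFactors, (1 - (q : ℝ)⁻¹)⁻¹) ^ 2)
    (h3 : ∀ j ∈ ({1, 2, 3} : Finset ℕ), ∀ d r : ℕ, 1 ≤ d → 1 ≤ r →
      ((d * r : ℕ) : ℝ) < Skeleton.P1 D → ∀ x : ℝ, 1 ≤ x → x ≤ bigT D →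
        ∑ n ∈ Finset.Ico 1 ⌈x⌉₊, ‖xiZero c' D j n d r‖ / n ≤ C₃ * ell D * (1 + Real.log x) ^ 3)
    {j : ℕ} (hj : j ∈ ({1, 2, 3} : Finset ℕ)) :
    ‖(∑ n ∈ ((Finset.Ico 1 (Nsupp D)).filter
          (fun n : ℕ => P1pp D < n ∧ (n : ℝ) < Skeleton.P2 D)).filter
            (fun n : ℕ => ¬ ((n : ℝ) < Skeleton.P3 D)),
        ∑ r ∈ n.divisors,
          (if Squarefree r then
            (‖χ (n : ZMod D)‖ : ℂ) * lamZero c' D j n / (n : ℂ) / (Nat.totient r : ℂ) *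
              Typed.Sec12B.sum121 c' χ j n * nSum22 c' χ j (n / r) r else 0)) -
      deriv χ.LFunction 1 ^ 2 * iota4 / (0.504 * 0.5 * (Real.log (bigP D) : ℂ) ^ 2) *
        ∑ n ∈ ((Finset.Ico 1 (Nsupp D)).filter
            (fun n : ℕ => P1pp D < n ∧ (n : ℝ) < Skeleton.P2 D)).filter
              (fun n : ℕ => ¬ ((n : ℝ) < Skeleton.P3 D)),
          (‖χ (n : ZMod D)‖ : ℂ) * lamZero c' D j n / (Nat.totient n : ℂ) *
            (frakgW c' D j 7 (bigP D ^ (0.5 : ℝ) / n) *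
              ((((n : ℝ) / P1pp D : ℝ) : ℂ) ^ (-beta6 D) *
                (-1 + (beta6 D - betaJ c' D j) * (Real.log ((n : ℝ) / P1pp D) : ℂ))))‖ ≤
      Real.exp 256 *
          ((28000 * Real.exp (9 / 2) + 2 * max C₁ 0 + 2000 * Real.exp (9 / 2) * (4 * π) * 520) * 9 *
              max C₂ 0 +
            (2 * max C₁ 0 + 2000 * Real.exp (9 / 2) * (4 * π) * 520) * (4 * Real.exp (9 / 2)) * 146 * 9 +
            537 * (2 * max C₁ 0 + 28000 * Real.exp (9 / 2)) * 9 *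
              (584 * Real.exp (9 / 2) + max C₂ 0 + 8 * max C₃ 0) +
            537 * (28000 * Real.exp (9 / 2)) * (4 * Real.exp (9 / 2)) * 146 * 9 +
            28000 * Real.exp (9 / 2) * (4 * Real.exp (9 / 2)) * 100000) *
        (ell D ^ (1.1 : ℝ)) ^ 5 * (ell D ^ 15)⁻¹ := by
  classical
  have hℓ : 3 ≤ ell D := by linarith
  have hℓ1 : 1 ≤ ell D := by linarith
  have hℓ0 : 0 < ell D := by linarith
  have h020' := body020_mono c' χ (le_max_left C₁ 0) h020
  have h84' := body84_mono c' χ (le_max_left C₂ 0) h84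
  have h3' := body3_mono c' (le_max_left C₃ 0) h3
  have hA := seven_assembly_le c' χ hℓ4 hq hp hc5 (le_max_right C₁ 0) (le_max_right C₂ 0)
    (le_max_right C₃ 0) hTc h020' h84' h3' hj
  have hB := seven_Gswap_le c' χ hℓ4 hp hc5 j
  have hC := seven_mainterm_eq c' χ hℓ j
  rw [hC] at hB
  rw [Skeleton.log_bigT] at hA
  refine (norm_sub_le_norm_sub_add_norm_sub _ _ _).trans ((add_le_add hA hB).trans ?_)
  -- weights
  have hτ := ell_le_rpow' (D := D) hℓ1
  have h9 : 3 + 0.002 * ell D ^ 9 ≤ ell D ^ 9 := by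
    have : (3 : ℝ) ^ 9 ≤ ell D ^ 9 := pow_le_pow_left₀ (by norm_num) hℓ 9
    nlinarith
  have hWa := (seven_weights_all_le c' χ hℓ j).trans
    (mul_le_mul_of_nonneg_left h9 (Real.exp_pos _).le)
  have hWw : _ ≤ 537 * Real.exp 256 * ell D ^ (1.1 : ℝ) :=
    (seven_weights_window_le c' χ hℓ j).trans (by nlinarith [Real.exp_pos 256])
  have hWm : (∑ n ∈ (((Finset.Ico 1 (Nsupp D)).filter
          (fun n : ℕ => P1pp D < n ∧ (n : ℝ) < Skeleton.P2 D)).filter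
            (fun n : ℕ => ¬ ((n : ℝ) < Skeleton.P3 D))).filter
            (fun n : ℕ => (n : ℝ) < bigP D ^ (0.5 : ℝ) / bigT D ^ 11),
        ‖(‖χ (n : ZMod D)‖ : ℂ) * lamZero c' D j n / (n : ℂ)‖ * ((n : ℝ) / Nat.totient n) ^ 3) ≤
      Real.exp 256 * ell D ^ 9 :=
    (Finset.sum_le_sum_of_subset_of_nonneg (Finset.filter_subset _ _)
      (fun n _ _ => by positivity)).trans hWa
  exact mid_numeric_bound (C₁ := 2 * max C₁ 0) (τ := ell D ^ (1.1 : ℝ)) (L := ‖deriv χ.LFunction 1‖)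
    (R := ‖iota3‖ / Real.log (Skeleton.P3 D) + ‖iota4‖ / Real.log (Skeleton.P2 D))
    hℓ hτ hWm hWw hWa (iotaR_nonneg hℓ) (iotaR_le hℓ) (norm_nonneg _)
    (norm_deriv_L_one_le χ hℓ hp) (by positivity) (le_max_right _ _) (le_max_right _ _)

end AtModulus

end TopRangeA15

/-! ## The edge: the top range of `S_j(𝐚₁₅,𝐚₂₂)` (Z22:§12.u049, exact reading) from the relative Lemma 8.4 -/

section Edge

open TopRangeA15

variable (c' : ℝ)

/-- **DAG node Z22:§12.u049 (sum form) in the EXACT reading of Lemma 12.1, as an edge from the relative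
Lemma 8.4** [cite: Zhang2022LandauSiegel, §12 p. 73 (tex L3694)]: for every `ε > 0`, all large `D`,
every real primitive `χ (mod D)` with (A), the sequence `a₁₅ = χϰ₁₃` and `j ∈ {1,2,3}`,
`‖S_j(𝐚₁₅,𝐚₂₂)|_{P″₁<dr<P₂} − (L′²ι₃/((0.504)(0.498)log²P))Σ_{P″₁<n<P₃}|χ(n)|λ₀ⱼ(n)φ(n)⁻¹𝓖_{j6}(P^{0.498}/n)𝓦*ex_j(n)
 − (L′²ι₄/((0.504)(0.5)log²P))Σ_{P″₁<n<P₂}|χ(n)|λ₀ⱼ(n)φ(n)⁻¹𝓖_{j7}(P^{0.5}/n)𝓦*ex_j(n)‖ ≤ εα`,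
`𝓦*ex_j(n) = (n/P″₁)^{−β₆}(−1 + (β₆ − β_j)log(n/P″₁))`. Inputs: `Typed.Sec12B.U020_holds` (exact Lemma 12.1),
the hypothesis `Skeleton.Lemma84Rel c′`, and `XiZeroMajorant.xiZeroTailMean`. -/
theorem sjOn_top_a15_sum_of_rel (h84 : Lemma84Rel c') :
    ∀ ε : ℝ, 0 < ε → ForAllLarge fun D _ χ => AssumptionA D χ →
      ∀ a15 : ℕ → ℂ, (∀ n, a15 n = χ (n : ZMod D) * vk13 D n) →
        ∀ j ∈ ({1, 2, 3} : Finset ℕ),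
          ‖SjOn c' D j a15 (a22 χ) (rngTop D) -
              (deriv χ.LFunction 1 ^ 2 * iota3 / (0.504 * 0.498 * (Real.log (bigP D) : ℂ) ^ 2) *
                  ∑ n ∈ (Finset.Ico 1 (Nsupp D)).filter
                      (fun n : ℕ => P1pp D < n ∧ (n : ℝ) < Skeleton.P3 D),
                    (‖χ (n : ZMod D)‖ : ℂ) * lamZero c' D j n / (Nat.totient n : ℂ) *
                      (frakgW c' D j 6 (bigP D ^ (0.498 : ℝ) / n) *
                        ((((n : ℝ) / P1pp D : ℝ) : ℂ) ^ (-beta6 D) *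
                          (-1 + (beta6 D - betaJ c' D j) * (Real.log ((n : ℝ) / P1pp D) : ℂ)))) +
                deriv χ.LFunction 1 ^ 2 * iota4 / (0.504 * 0.5 * (Real.log (bigP D) : ℂ) ^ 2) *
                  ∑ n ∈ (Finset.Ico 1 (Nsupp D)).filter
                      (fun n : ℕ => P1pp D < n ∧ (n : ℝ) < Skeleton.P2 D),
                    (‖χ (n : ZMod D)‖ : ℂ) * lamZero c' D j n / (Nat.totient n : ℂ) *
                      (frakgW c' D j 7 (bigP D ^ (0.5 : ℝ) / n) *
                        ((((n : ℝ) / P1pp D : ℝ) : ℂ) ^ (-beta6 D) *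
                          (-1 + (beta6 D - betaJ c' D j) * (Real.log ((n : ℝ) / P1pp D) : ℂ)))))‖ ≤
            ε * alpha D := by
  classical
  intro ε hε
  obtain ⟨c, hc, C₁, H020⟩ := Typed.Sec12B.U020_holds c'
  obtain ⟨C₂, H84⟩ := h84
  obtain ⟨C₃, H3⟩ := XiZeroMajorant.xiZeroTailMean c'
  set K : ℝ := Real.exp 256 *
          ((28000 * Real.exp (9 / 2) + 2 * max C₁ 0 + 2000 * Real.exp (9 / 2) * (4 * π) * 520) * 9 *
              max C₂ 0 +
            (2 * max C₁ 0 + 2000 * Real.exp (9 / 2) * (4 * π) * 520) * (4 * Real.exp (9 / 2)) * 146 * 9 +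
            537 * (2 * max C₁ 0 + 28000 * Real.exp (9 / 2)) * 9 *
              (584 * Real.exp (9 / 2) + max C₂ 0 + 8 * max C₃ 0) +
            537 * (28000 * Real.exp (9 / 2)) * (4 * Real.exp (9 / 2)) * 146 * 9 +
            28000 * Real.exp (9 / 2) * (4 * Real.exp (9 / 2)) * 100000) with hK
  have hK0 : 0 ≤ K := by positivity
  have h2K0 : 0 ≤ 2 * K := by positivity
  set x : ℝ := max 4 (max (5 * |c'| * π) (max ((15 / c) ^ 10) ((2 * K) ^ 2 / (ε ^ 2 * π ^ 2))))
    with hx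
  have FL : ForAllLarge fun D _ _ => 4 ≤ ell D ∧ 5 * |c'| * π ≤ ell D ∧ (15 / c) ^ 10 ≤ ell D ∧
      (2 * K) ^ 2 / (ε ^ 2 * π ^ 2) ≤ ell D := by
    refine ForAllLarge.of_le ⌈Real.exp x⌉₊ fun D _ χ hD _ _ => ?_
    have hxℓ := le_ell_of_ceil_exp_le hD
    refine ⟨?_, ?_, ?_, ?_⟩ <;> refine le_trans ?_ hxℓ <;> simp [hx]
  refine (((H020.and H84).and H3).and FL).mono ?_
  intro D _ χ hq hp ⟨⟨⟨hA, hB⟩, hC⟩, h4, h5, h15, hKℓ⟩ hAss a15 ha15 j hj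
  have hℓ : 3 ≤ ell D := by linarith
  have hℓ1 : 1 ≤ ell D := by linarith
  have hℓ4' : 4 ≤ Real.log D := by simpa only [ell] using h4
  have hc5 := hc5_of_le c' hℓ h5
  have hTc := bigT_rpow_neg_le_fifteen hc hℓ1 h15
  have hP3P2 : Skeleton.P3 D ≤ Skeleton.P2 D := Sec12D.P3_le_P2 hℓ4'
  obtain ⟨-, -, hb5, h5504, -, -, -⟩ := range_facts (D := D) hℓ
  obtain ⟨-, -, hP2le, hP3def, -⟩ := window_facts (D := D) hℓ
  have h6 := six_at c' χ h4 hq hp hc5 hTc (hA hAss) (hB hAss) hC hj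
  have h7 := seven_at c' χ h4 hq hp hc5 hTc (hA hAss) (hB hAss) hC hj
  -- the two pieces of the range
  set S := (Finset.Ico 1 (Nsupp D)).filter
      (fun n : ℕ => P1pp D < n ∧ (n : ℝ) < Skeleton.P2 D) with hSdef
  set S₆ := (Finset.Ico 1 (Nsupp D)).filter
      (fun n : ℕ => P1pp D < n ∧ (n : ℝ) < Skeleton.P3 D) with hS₆def
  set S₇ := S.filter (fun n : ℕ => ¬ ((n : ℝ) < Skeleton.P3 D)) with hS₇def
  have hS6 : S.filter (fun n : ℕ => (n : ℝ) < Skeleton.P3 D) = S₆ := by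
    ext n
    simp only [hSdef, hS₆def, Finset.mem_filter]
    constructor
    · rintro ⟨⟨h1, h2, -⟩, h3⟩; exact ⟨h1, h2, h3⟩
    · rintro ⟨h1, h2, h3⟩; exact ⟨⟨h1, h2, lt_of_lt_of_le h3 hP3P2⟩, h3⟩
  -- the left side, split at `P₃` and re-indexed
  have hL6 : SjOn c' D j a15 (a22 χ) (fun k => rngTop D k ∧ (k : ℝ) < Skeleton.P3 D) =
      ∑ n ∈ S₆, ∑ r ∈ n.divisors,
        (if Squarefree r then
          (‖χ (n : ZMod D)‖ : ℂ) * lamZero c' D j n / (n : ℂ) / (Nat.totient r : ℂ) *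
            Typed.Sec12B.sum121 c' χ j n * nSum22 c' χ j (n / r) r else 0) := by
    rw [Sec12D.SjOn_congr c' j a15 (a22 χ) (R' := fun k : ℕ => P1pp D < k ∧ (k : ℝ) < Skeleton.P3 D)
      (fun k => ⟨fun h => ⟨h.1.1, h.2⟩, fun h => ⟨⟨h.1, lt_of_lt_of_le h.2 hP3P2⟩, h.2⟩⟩)]
    exact SjOn_a15_eq_divisor_sum c' χ hℓ hq j a15 ha15 _
      (fun n hn => by rw [hP3def] at hn; linarith [hn.2])
  have hL7 : SjOn c' D j a15 (a22 χ) (fun k => rngTop D k ∧ ¬ ((k : ℝ) < Skeleton.P3 D)) =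
      ∑ n ∈ S₇, ∑ r ∈ n.divisors,
        (if Squarefree r then
          (‖χ (n : ZMod D)‖ : ℂ) * lamZero c' D j n / (n : ℂ) / (Nat.totient r : ℂ) *
            Typed.Sec12B.sum121 c' χ j n * nSum22 c' χ j (n / r) r else 0) := by
    have hS7 : (Finset.Ico 1 (Nsupp D)).filter
        (fun n : ℕ => rngTop D n ∧ ¬ ((n : ℝ) < Skeleton.P3 D)) = S₇ := by
      ext n
      simp only [hS₇def, hSdef, Finset.mem_filter, rngTop, and_assoc]
    rw [← hS7]
    exact SjOn_a15_eq_divisor_sum c' χ hℓ hq j a15 ha15 _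
      (fun n hn => by have := hn.1.2; linarith)
  rw [← Sec12D.SjOn_split c' j a15 (a22 χ) (rngTop D) (fun k => (k : ℝ) < Skeleton.P3 D), hL6, hL7,
    ← Finset.sum_filter_add_sum_filter_not S (fun n : ℕ => (n : ℝ) < Skeleton.P3 D), hS6]
  -- bookkeeping
  set A₆ := ∑ n ∈ S₆, ∑ r ∈ n.divisors,
        (if Squarefree r then
          (‖χ (n : ZMod D)‖ : ℂ) * lamZero c' D j n / (n : ℂ) / (Nat.totient r : ℂ) *
            Typed.Sec12B.sum121 c' χ j n * nSum22 c' χ j (n / r) r else 0) with hA₆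
  set A₇ := ∑ n ∈ S₇, ∑ r ∈ n.divisors,
        (if Squarefree r then
          (‖χ (n : ZMod D)‖ : ℂ) * lamZero c' D j n / (n : ℂ) / (Nat.totient r : ℂ) *
            Typed.Sec12B.sum121 c' χ j n * nSum22 c' χ j (n / r) r else 0) with hA₇
  set T6 := ∑ n ∈ S₆, (‖χ (n : ZMod D)‖ : ℂ) * lamZero c' D j n / (Nat.totient n : ℂ) *
      (frakgW c' D j 6 (bigP D ^ (0.498 : ℝ) / n) *
        ((((n : ℝ) / P1pp D : ℝ) : ℂ) ^ (-beta6 D) *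
          (-1 + (beta6 D - betaJ c' D j) * (Real.log ((n : ℝ) / P1pp D) : ℂ)))) with hT6
  set T7a := ∑ n ∈ S₆, (‖χ (n : ZMod D)‖ : ℂ) * lamZero c' D j n / (Nat.totient n : ℂ) *
      (frakgW c' D j 7 (bigP D ^ (0.5 : ℝ) / n) *
        ((((n : ℝ) / P1pp D : ℝ) : ℂ) ^ (-beta6 D) *
          (-1 + (beta6 D - betaJ c' D j) * (Real.log ((n : ℝ) / P1pp D) : ℂ)))) with hT7a
  set T7b := ∑ n ∈ S₇, (‖χ (n : ZMod D)‖ : ℂ) * lamZero c' D j n / (Nat.totient n : ℂ) *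
      (frakgW c' D j 7 (bigP D ^ (0.5 : ℝ) / n) *
        ((((n : ℝ) / P1pp D : ℝ) : ℂ) ^ (-beta6 D) *
          (-1 + (beta6 D - betaJ c' D j) * (Real.log ((n : ℝ) / P1pp D) : ℂ)))) with hT7b
  set p6 := deriv χ.LFunction 1 ^ 2 * iota3 / (0.504 * 0.498 * (Real.log (bigP D) : ℂ) ^ 2) with hp6
  set p7 := deriv χ.LFunction 1 ^ 2 * iota4 / (0.504 * 0.5 * (Real.log (bigP D) : ℂ) ^ 2) with hp7
  have e : A₆ + A₇ - (p6 * T6 + p7 * (T7a + T7b)) = (A₆ - (p6 * T6 + p7 * T7a)) + (A₇ - p7 * T7b) := by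
    ring
  rw [e]
  refine (norm_add_le _ _).trans ((add_le_add h6 h7).trans ?_)
  have hfin := K_tau5_le_eps_alpha h2K0 hε hℓ hKℓ
  rw [hK] at hfin
  linarith [hfin]

end Edge


end Literature.NumberTheory.LFunctions.Zhang2022.Typed.Sec12C
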